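import Mathlib.Analysis.SpecialFunctions.Pow.Deriv
import Mathlib.Analysis.SpecialFunctions.Integrability.Basic
import Mathlib.Analysis.Calculus.ParametricIntervalIntegral
import Mathlib.MeasureTheory.Integral.DominatedConvergence
import Literature.Probability.RandomPlanarGeometry.CritPercCardyFunctionProofs
import Literature.Probability.RandomPlanarGeometry.ConformalMapRiemannProofs
import HarnessLib

/-!
# The Schwarz–Christoffel map of the equilateral triangle

This file discharges the named fact `Literature.Probability.RandomPlanarGeometry.schwarzTriangleMap_isUniformizing`
(`Literature.Probability.RandomPlanarGeometry.CritPercCardyFunctionProofs`; Berenstein–Gay 1991,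
§2.8, Prop. 2.8.14 and Example (2)): the normalised Schwarz–Christoffel integral
`Ψ = S / B(1/3,1/3)`, `S(w) = ∫_0^w t^{-2/3} (1 - t)^{-2/3} dt`, is a conformal equivalence of `ℍₒ`
onto the open equilateral triangle `T₀` with vertices `Ψ(0) = 0`, `Ψ(1) = 1`, `Ψ(∞) = ζ = e^{iπ/3}`
(`Literature.Probability.RandomPlanarGeometry.refEquilateralTriangle`), with boundary values `B(u;1/3,1/3)/B(1/3,1/3)` at `u ∈ [0, 1]`,
points of the open sides `(ζ, 0)`, `(1, ζ)` at `u < 0`, `u > 1`, and `ζ` at `∞`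
(`Literature.Probability.RandomPlanarGeometry.schwarzTriangleMap_isUniformizing_holds`, `Literature.Probability.RandomPlanarGeometry.scUniformizer`).

## Part 1: analysis of the explicit formula

Substituting `t = sw` and using `(sw)^{-2/3} = s^{-2/3} w^{-2/3}` (`s > 0`, `w ∈ ℍₒ`),

`S(w) = w^{1/3} h(w)`, `h(w) = ∫_0^1 s^{-2/3} (1 - sw)^{-2/3} ds` (`Literature.Probability.RandomPlanarGeometry.scFun`, `Literature.Probability.RandomPlanarGeometry.scAux`),

with principal-branch powers.

* `h` is holomorphic on the slit domain `ℂ ∖ [1, ∞)` (`Literature.Probability.RandomPlanarGeometry.scDomain`; differentiation under the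
  integral sign, `hasDerivAt_integral_of_dominated_loc_of_deriv_le`), and
  `S' = w^{-2/3}(1-w)^{-2/3}` (`Literature.Probability.RandomPlanarGeometry.hasDerivAt_scFun`, an integration by parts in `s`:
  `h + 3w h' = 3(1-w)^{-2/3}`); `S = schwarzTriangleMap` on `ℍₒ` (`Literature.Probability.RandomPlanarGeometry.schwarzTriangleMap_eq_scFun`).
* Real boundary values: `S(u) = B(u; 1/3, 1/3)` for `u ∈ [0, 1)` (`Literature.Probability.RandomPlanarGeometry.scFun_ofReal`), the
  reflection identity `S(w) + S(1 - w) = B(1/3, 1/3)` (`Literature.Probability.RandomPlanarGeometry.scFun_add_scFun_one_sub_eq`, equal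
  derivatives on a star-convex domain), whence the boundary value `B(1/3,1/3)` at `1`
  (`Literature.Probability.RandomPlanarGeometry.tendsto_scFun_of_mem_Icc`).
* `Im S > 0` on `ℍₒ` (`Literature.Probability.RandomPlanarGeometry.scFun_im_pos`): the integrand `w^{1/3}(1 - sw)^{-2/3}` has argument in
  `(0, π)` by the angle estimate `arg w + |arg (1 - sw)| < π`.
* Injectivity of `S` on `ℍₒ` (`Literature.Probability.RandomPlanarGeometry.scFun_injOn`): `G = S ∘ exp` on the strip `{0 < im < π}` has
  `Re (e^{-iπ/3} G') > 0`, so `G` is injective by the Noshiro–Warschawski argument (monotonicity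
  along segments of the convex strip).
* The Möbius symmetry `S(1 - 1/w) = ζ (B(1/3,1/3) - S(w))` (`Literature.Probability.RandomPlanarGeometry.scFun_one_sub_inv`; equal
  derivatives, constant fixed at `w → 1`), and from it the boundary values on `(-∞, 0)` (points of
  the open side `(0, ζB)`), on `(1, ∞)` (points of the open side `(B, ζB)`) and at `∞` (the apex
  `ζ B`) (`Literature.Probability.RandomPlanarGeometry.tendsto_scFun_of_neg`, `Literature.Probability.RandomPlanarGeometry.tendsto_scFun_of_one_lt`, `Literature.Probability.RandomPlanarGeometry.tendsto_scFun_atInfty`).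

## Part 2: the image and the uniformization

With Part 1, `Ψ` (`Literature.Probability.RandomPlanarGeometry.scPsi`) is holomorphic and injective on `ℍₒ` with zero-free derivative,
`Im Ψ > 0`, and `Ψ` has a limit at every boundary point of `ℍₒ` (including `∞`), each lying in the
closed triangle and on one of its three side lines (`Literature.Probability.RandomPlanarGeometry.scGood`). The identification of the image
`O = Ψ(ℍₒ)` is then purely topological (a connectedness substitute for the argument principle of
the printed proof, Berenstein–Gay 1991, pp. 208–211):

* `O` is open (inverse function theorem, `Complex.isOpen_image_of_deriv_ne_zero`);
* every point of `closure O ∖ O` is a boundary value of `Ψ` (`Literature.Probability.RandomPlanarGeometry.mem_image_or_of_mem_closure`;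
  compactness: `Ψ` extends continuously to `{im ≥ 0}` and tends to `ζ` at `∞`);
* each open outer half-plane `Hᵢ` of the triangle (`Literature.Probability.RandomPlanarGeometry.scOuter`) is connected, misses
  `closure O ∖ O`, and is not contained in `O ⊆ ℍₒ`, so `Hᵢ ∩ O = ∅`; with openness of `O` this
  puts `O` inside `T₀` (`Literature.Probability.RandomPlanarGeometry.scPsi_image_subset`);
* `T₀` is connected, misses `closure O ∖ O` and meets `O`, so `T₀ ⊆ O` (`Literature.Probability.RandomPlanarGeometry.subset_scPsi_image`).

The holomorphic inverse comes from `Complex.differentiableOn_invFunOn_image`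
(`Literature.Analysis.Complex.RiemannMapping`), packaged by `Literature.Probability.RandomPlanarGeometry.ConformalEquiv.ofBijOn`.

Only elementary complex analysis from Mathlib is used (no argument principle, no general
Schwarz–Christoffel theory).

## References

* C. A. Berenstein, R. Gay, *Complex Variables*, GTM 125, Springer (1991), §2.8, pp. 207–211
  (Schwarz–Christoffel transformations; Prop. 2.8.14; Example (2), the equilateral triangle).
* Z. Nehari, *Conformal Mapping*, McGraw-Hill (1952), Ch. V §6.
* K. Noshiro, *On the theory of schlicht functions*, J. Fac. Sci. Hokkaido Univ. 2 (1934) 129–155;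
  S. E. Warschawski, *On the higher derivatives at the boundary in conformal mapping*,
  Trans. AMS 38 (1935) 310–340 (the univalence criterion `Re f' > 0` on convex domains).
-/

open Set Filter Topology Complex MeasureTheory Metric
open scoped Real
open UpperHalfPlane (upperHalfPlaneSet isOpen_upperHalfPlaneSet)
open scoped Interval

noncomputable section

namespace Literature.Probability.RandomPlanarGeometry

/-! ### The slit domain `ℂ \ [1, ∞)` -/

/-- The slit domain `ℂ \ [1, ∞)`, on which `w ↦ (1 - sw)^{-2/3}` (`s ∈ [0,1]`, principal branch)
and hence the Schwarz–Christoffel factor `h(w) = ∫_0^1 s^{-2/3}(1 - sw)^{-2/3} ds` are holomorphic. [folklore] -/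
def scDomain : Set ℂ := {w : ℂ | w.im ≠ 0 ∨ w.re < 1}

/-- `ℂ \ [1, ∞)` is open. [folklore] -/
theorem isOpen_scDomain : IsOpen scDomain :=
  (isOpen_ne_fun continuous_im continuous_const).union (isOpen_lt continuous_re continuous_const)

/-- `ℍₒ ⊆ ℂ \ [1, ∞)`. [folklore] -/
theorem upperHalfPlaneSet_subset_scDomain : upperHalfPlaneSet ⊆ scDomain :=
  fun _ hw => Or.inl (ne_of_gt hw)

/-- Real points `u < 1` lie in `ℂ \ [1, ∞)`. [folklore] -/
theorem ofReal_mem_scDomain {u : ℝ} (hu : u < 1) : (u : ℂ) ∈ scDomain := Or.inr (by simpa using hu)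

/-- For `w ∈ ℂ \ [1, ∞)` and `s ∈ [0, 1]`, `1 - sw` lies in the slit plane `ℂ \ (-∞, 0]`, so the
principal power `(1 - sw)^{-2/3}` is holomorphic in `w`. [folklore] -/
theorem one_sub_mul_mem_slitPlane {w : ℂ} (hw : w ∈ scDomain) {s : ℝ} (hs : s ∈ Icc (0 : ℝ) 1) :
    1 - (s : ℂ) * w ∈ slitPlane := by
  rw [mem_slitPlane_iff]
  simp only [sub_re, one_re, mul_re, ofReal_re, ofReal_im, zero_mul, sub_zero, sub_im, one_im,
    mul_im, add_zero, zero_sub, ne_eq, neg_eq_zero, mul_eq_zero, not_or]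
  rcases eq_or_lt_of_le hs.1 with h0 | hs0
  · left; rw [← h0]; simp
  · rcases hw with h | h
    · right; exact ⟨hs0.ne', h⟩
    · left; nlinarith [hs.2]

/-- Points near a point of the open set `ℂ \ [1, ∞)`: a closed ball inside it. [folklore] -/
theorem exists_closedBall_subset_scDomain {w₀ : ℂ} (hw₀ : w₀ ∈ scDomain) :
    ∃ ε > 0, closedBall w₀ ε ⊆ scDomain := by
  obtain ⟨ε, hε, h⟩ := Metric.isOpen_iff.1 isOpen_scDomain w₀ hw₀
  exact ⟨ε / 2, half_pos hε, closedBall_subset_ball (half_lt_self hε) |>.trans h⟩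

/-- On a compact subset `K` of `ℂ \ [1, ∞)`, `|1 - sw|` (`s ∈ [0,1]`, `w ∈ K`) is bounded below by a
positive constant. [folklore] -/
theorem exists_pos_le_norm_one_sub_mul {K : Set ℂ} (hK : IsCompact K) (hKsub : K ⊆ scDomain) :
    ∃ δ > 0, ∀ w ∈ K, ∀ s ∈ Icc (0 : ℝ) 1, δ ≤ ‖1 - (s : ℂ) * w‖ := by
  rcases K.eq_empty_or_nonempty with rfl | hne
  · exact ⟨1, one_pos, by simp⟩
  have hc : ContinuousOn (fun p : ℝ × ℂ => ‖1 - (p.1 : ℂ) * p.2‖) (Icc (0 : ℝ) 1 ×ˢ K) := by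
    fun_prop
  obtain ⟨p, hp, hmin⟩ := (isCompact_Icc.prod hK).exists_isMinOn
    ((nonempty_Icc.2 zero_le_one).prod hne) hc
  refine ⟨‖1 - (p.1 : ℂ) * p.2‖, ?_, fun w hw s hs => ?_⟩
  · exact norm_pos_iff.2 (slitPlane_ne_zero (one_sub_mul_mem_slitPlane (hKsub hp.2) hp.1))
  · exact hmin (mk_mem_prod hs hw)

/-! ### The kernel `s^{-2/3} (1 - sw)^{-2/3}` and its `w`-derivative -/

/-- The kernel `k(w, s) = s^{-2/3} (1 - sw)^{-2/3}` of `h(w) = ∫_0^1 k(w, s) ds` (real power of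
`s`, principal complex power of `1 - sw`). [cite: BerensteinGay1991, §2.8 Example (2)] -/
def scKernel (w : ℂ) (s : ℝ) : ℂ :=
  ((s ^ (-(2 / 3 : ℝ)) : ℝ) : ℂ) * (1 - (s : ℂ) * w) ^ (-(2 / 3 : ℂ))

/-- The `w`-derivative `∂k/∂w = s^{-2/3} · (-2/3)(1 - sw)^{-5/3} · (-s)` of the kernel. [folklore] -/
def scKernelDeriv (w : ℂ) (s : ℝ) : ℂ :=
  ((s ^ (-(2 / 3 : ℝ)) : ℝ) : ℂ) * (-(2 / 3 : ℂ) * (1 - (s : ℂ) * w) ^ (-(2 / 3 : ℂ) - 1) * (-(s : ℂ)))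

/-- The Schwarz–Christoffel factor `h(w) = ∫_0^1 s^{-2/3} (1 - sw)^{-2/3} ds`. [cite: BerensteinGay1991, §2.8 Example (2)] -/
def scAux (w : ℂ) : ℂ := ∫ s in (0 : ℝ)..1, scKernel w s

/-- The Schwarz–Christoffel map of the equilateral triangle in factored form,
`S(w) = w^{1/3} h(w) = w^{1/3} ∫_0^1 s^{-2/3}(1 - sw)^{-2/3} ds` (`= ∫_0^w t^{-2/3}(1-t)^{-2/3} dt`;
principal branches). It agrees with `schwarzTriangleMap` on `ℍₒ`. [cite: BerensteinGay1991, §2.8 Example (2)] -/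
def scFun (w : ℂ) : ℂ := w ^ (1 / 3 : ℂ) * scAux w

/-- The Schwarz–Christoffel integrand `S'(w) = w^{-2/3} (1 - w)^{-2/3}` (principal branches). [cite: BerensteinGay1991, §2.8 Example (2)] -/
def scDeriv (w : ℂ) : ℂ := w ^ (-(2 / 3 : ℂ)) * (1 - w) ^ (-(2 / 3 : ℂ))

/-- The kernel is holomorphic in `w ∈ ℂ \ [1, ∞)` with derivative `scKernelDeriv`. [folklore] -/
theorem hasDerivAt_scKernel {w : ℂ} (hw : w ∈ scDomain) {s : ℝ} (hs : s ∈ Icc (0 : ℝ) 1) :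
    HasDerivAt (fun w => scKernel w s) (scKernelDeriv w s) w := by
  unfold scKernel scKernelDeriv
  refine HasDerivAt.const_mul _ ?_
  have h1 : HasDerivAt (fun w : ℂ => 1 - (s : ℂ) * w) (-(s : ℂ)) w := by
    simpa using ((hasDerivAt_id w).const_mul (s : ℂ)).const_sub 1
  exact h1.cpow_const (one_sub_mul_mem_slitPlane hw hs)

/-- The exponent `-2/3` as a real number cast to `ℂ`. [folklore] -/
theorem neg_two_thirds_eq_cast : (-(2 / 3 : ℂ)) = ((-(2 / 3) : ℝ) : ℂ) := by push_cast; ring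

/-- The exponent `-5/3` as a real number cast to `ℂ`. [folklore] -/
theorem neg_five_thirds_eq_cast : (-(2 / 3 : ℂ) - 1) = ((-(5 / 3) : ℝ) : ℂ) := by push_cast; ring

/-- Norm of the kernel: `‖k(w,s)‖ = s^{-2/3} ‖1 - sw‖^{-2/3}` for `s ≥ 0`. [folklore] -/
theorem norm_scKernel (w : ℂ) {s : ℝ} (hs : 0 ≤ s) :
    ‖scKernel w s‖ = s ^ (-(2 / 3 : ℝ)) * ‖1 - (s : ℂ) * w‖ ^ (-(2 / 3 : ℝ)) := by
  rw [scKernel, norm_mul, Complex.norm_real, Real.norm_of_nonneg (Real.rpow_nonneg hs _),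
    neg_two_thirds_eq_cast, norm_cpow_real]

/-- Norm of the `w`-derivative of the kernel: `‖∂k/∂w‖ = (2/3) s^{1/3} ‖1 - sw‖^{-5/3} ≤ …`; we
record the crude bound `‖∂k/∂w‖ ≤ s^{-2/3} ‖1 - sw‖^{-5/3}` for `s ∈ [0, 1]`. [folklore] -/
theorem norm_scKernelDeriv_le (w : ℂ) {s : ℝ} (hs : s ∈ Icc (0 : ℝ) 1) :
    ‖scKernelDeriv w s‖ ≤ s ^ (-(2 / 3 : ℝ)) * ‖1 - (s : ℂ) * w‖ ^ (-(5 / 3 : ℝ)) := by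
  rw [scKernelDeriv, norm_mul, Complex.norm_real, Real.norm_of_nonneg (Real.rpow_nonneg hs.1 _),
    norm_mul, norm_mul, neg_five_thirds_eq_cast, norm_cpow_real, norm_neg, norm_neg, Complex.norm_real,
    Real.norm_of_nonneg hs.1]
  have h1 : ‖(2 / 3 : ℂ)‖ ≤ 1 := by
    rw [show (2 / 3 : ℂ) = ((2 / 3 : ℝ) : ℂ) by push_cast; ring, Complex.norm_real,
      Real.norm_of_nonneg (by norm_num)]
    norm_num
  have h0 : 0 ≤ ‖1 - (s : ℂ) * w‖ ^ (-(5 / 3 : ℝ)) := Real.rpow_nonneg (norm_nonneg _) _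
  have h2 : 0 ≤ s ^ (-(2 / 3 : ℝ)) := Real.rpow_nonneg hs.1 _
  calc s ^ (-(2 / 3 : ℝ)) * (‖(2 / 3 : ℂ)‖ * ‖1 - (s : ℂ) * w‖ ^ (-(5 / 3 : ℝ)) * s)
      ≤ s ^ (-(2 / 3 : ℝ)) * (1 * ‖1 - (s : ℂ) * w‖ ^ (-(5 / 3 : ℝ)) * 1) := by
        refine mul_le_mul_of_nonneg_left ?_ h2
        refine mul_le_mul (mul_le_mul_of_nonneg_right h1 h0) hs.2 hs.1 (by positivity)
    _ = _ := by ring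

/-- Continuity of the kernel in `s ∈ (0, 1]` for `w ∈ ℂ \ [1, ∞)`. [folklore] -/
theorem continuousOn_scKernel {w : ℂ} (hw : w ∈ scDomain) : ContinuousOn (scKernel w) (Ioc 0 1) := by
  intro s hs
  refine ContinuousAt.continuousWithinAt ?_
  unfold scKernel
  refine ContinuousAt.mul ?_ ?_
  · exact (Complex.continuous_ofReal.continuousAt).comp
      (Real.continuousAt_rpow_const _ _ (Or.inl hs.1.ne'))
  · refine ContinuousAt.cpow (by fun_prop) continuousAt_const ?_
    exact one_sub_mul_mem_slitPlane hw ⟨hs.1.le, hs.2⟩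

/-- Continuity of the `w`-derivative of the kernel in `s ∈ (0, 1]` for `w ∈ ℂ \ [1, ∞)`. [folklore] -/
theorem continuousOn_scKernelDeriv {w : ℂ} (hw : w ∈ scDomain) :
    ContinuousOn (scKernelDeriv w) (Ioc 0 1) := by
  intro s hs
  refine ContinuousAt.continuousWithinAt ?_
  unfold scKernelDeriv
  refine ContinuousAt.mul ?_ (ContinuousAt.mul (ContinuousAt.mul continuousAt_const ?_) (by fun_prop))
  · exact (Complex.continuous_ofReal.continuousAt).comp
      (Real.continuousAt_rpow_const _ _ (Or.inl hs.1.ne'))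
  · refine ContinuousAt.cpow (by fun_prop) continuousAt_const ?_
    exact one_sub_mul_mem_slitPlane hw ⟨hs.1.le, hs.2⟩

/-- The kernel is measurable in `s` on `(0, 1]`. [folklore] -/
theorem aestronglyMeasurable_scKernel {w : ℂ} (hw : w ∈ scDomain) :
    AEStronglyMeasurable (scKernel w) (volume.restrict (Ι (0 : ℝ) 1)) := by
  rw [uIoc_of_le zero_le_one]
  exact (continuousOn_scKernel hw).aestronglyMeasurable measurableSet_Ioc

/-- The `w`-derivative of the kernel is measurable in `s` on `(0, 1]`. [folklore] -/
theorem aestronglyMeasurable_scKernelDeriv {w : ℂ} (hw : w ∈ scDomain) :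
    AEStronglyMeasurable (scKernelDeriv w) (volume.restrict (Ι (0 : ℝ) 1)) := by
  rw [uIoc_of_le zero_le_one]
  exact (continuousOn_scKernelDeriv hw).aestronglyMeasurable measurableSet_Ioc

/-- `s ↦ C s^{-2/3}` is integrable on `[0, 1]`. [folklore] -/
theorem intervalIntegrable_const_mul_rpow (C : ℝ) :
    IntervalIntegrable (fun s : ℝ => C * s ^ (-(2 / 3 : ℝ))) volume 0 1 :=
  (intervalIntegral.intervalIntegrable_rpow' (by norm_num)).const_mul C

/-- The kernel is integrable in `s ∈ [0, 1]` for `w ∈ ℂ \ [1, ∞)` (it is `O(s^{-2/3})`). [folklore] -/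
theorem intervalIntegrable_scKernel {w : ℂ} (hw : w ∈ scDomain) :
    IntervalIntegrable (scKernel w) volume 0 1 := by
  obtain ⟨δ, hδ, hδle⟩ := exists_pos_le_norm_one_sub_mul isCompact_singleton
    (singleton_subset_iff.2 hw)
  refine (intervalIntegrable_const_mul_rpow (δ ^ (-(2 / 3 : ℝ)))).mono_fun'
    (aestronglyMeasurable_scKernel hw) ?_
  rw [uIoc_of_le zero_le_one]
  refine (ae_restrict_iff' measurableSet_Ioc).2 (Eventually.of_forall fun s hs => ?_)
  show ‖scKernel w s‖ ≤ δ ^ (-(2 / 3 : ℝ)) * s ^ (-(2 / 3 : ℝ))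
  rw [norm_scKernel w hs.1.le, mul_comm]
  exact mul_le_mul_of_nonneg_right
    (Real.rpow_le_rpow_of_nonpos hδ (hδle w rfl s ⟨hs.1.le, hs.2⟩) (by norm_num))
    (Real.rpow_nonneg hs.1.le _)

/-- Differentiation under the integral sign for `h(w) = ∫_0^1 s^{-2/3}(1 - sw)^{-2/3} ds` on
`ℂ \ [1, ∞)` (dominated by `C s^{-2/3}` locally uniformly in `w`): the `w`-derivative of the kernel
is integrable and `h' = ∫ ∂k/∂w`. [folklore] -/
theorem intervalIntegrable_scKernelDeriv_and_hasDerivAt_scAux {w₀ : ℂ} (hw₀ : w₀ ∈ scDomain) :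
    IntervalIntegrable (scKernelDeriv w₀) volume 0 1 ∧
      HasDerivAt scAux (∫ s in (0 : ℝ)..1, scKernelDeriv w₀ s) w₀ := by
  obtain ⟨ε, hε, hball⟩ := exists_closedBall_subset_scDomain hw₀
  obtain ⟨δ, hδ, hδle⟩ := exists_pos_le_norm_one_sub_mul (isCompact_closedBall w₀ ε) hball
  have hball' : ball w₀ ε ⊆ scDomain := ball_subset_closedBall.trans hball
  have key := intervalIntegral.hasDerivAt_integral_of_dominated_loc_of_deriv_le
    (μ := volume) (a := (0 : ℝ)) (b := 1) (F := scKernel) (F' := scKernelDeriv) (x₀ := w₀)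
    (s := ball w₀ ε) (bound := fun s => δ ^ (-(5 / 3 : ℝ)) * s ^ (-(2 / 3 : ℝ)))
    (ball_mem_nhds w₀ hε) ?_ (intervalIntegrable_scKernel hw₀) (aestronglyMeasurable_scKernelDeriv hw₀)
    ?_ (intervalIntegrable_const_mul_rpow _) ?_
  · exact key
  · filter_upwards [ball_mem_nhds w₀ hε] with w hw using aestronglyMeasurable_scKernel (hball' hw)
  · refine Eventually.of_forall fun s hs w hw => ?_
    rw [uIoc_of_le zero_le_one] at hs
    refine (norm_scKernelDeriv_le w ⟨hs.1.le, hs.2⟩).trans ?_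
    rw [mul_comm]
    exact mul_le_mul_of_nonneg_right
      (Real.rpow_le_rpow_of_nonpos hδ (hδle w (ball_subset_closedBall hw) s ⟨hs.1.le, hs.2⟩)
        (by norm_num)) (Real.rpow_nonneg hs.1.le _)
  · refine Eventually.of_forall fun s hs w hw => ?_
    rw [uIoc_of_le zero_le_one] at hs
    exact hasDerivAt_scKernel (hball' hw) ⟨hs.1.le, hs.2⟩

/-- The `w`-derivative of the kernel is integrable in `s ∈ [0, 1]` for `w ∈ ℂ \ [1, ∞)`. [folklore] -/
theorem intervalIntegrable_scKernelDeriv {w : ℂ} (hw : w ∈ scDomain) :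
    IntervalIntegrable (scKernelDeriv w) volume 0 1 :=
  (intervalIntegrable_scKernelDeriv_and_hasDerivAt_scAux hw).1

/-- **Holomorphy of the Schwarz–Christoffel factor.** `h(w) = ∫_0^1 s^{-2/3}(1 - sw)^{-2/3} ds` is
complex differentiable on `ℂ \ [1, ∞)` with `h'(w) = ∫_0^1 ∂k/∂w (w, s) ds`. [folklore] -/
theorem hasDerivAt_scAux {w₀ : ℂ} (hw₀ : w₀ ∈ scDomain) :
    HasDerivAt scAux (∫ s in (0 : ℝ)..1, scKernelDeriv w₀ s) w₀ :=
  (intervalIntegrable_scKernelDeriv_and_hasDerivAt_scAux hw₀).2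

/-- `h` is holomorphic on `ℂ \ [1, ∞)`. [folklore] -/
theorem differentiableOn_scAux : DifferentiableOn ℂ scAux scDomain :=
  fun _ hw => (hasDerivAt_scAux hw).differentiableAt.differentiableWithinAt

/-- `h` is continuous on `ℂ \ [1, ∞)`. [folklore] -/
theorem continuousOn_scAux : ContinuousOn scAux scDomain := differentiableOn_scAux.continuousOn

/-- `S = w^{1/3} h` is holomorphic on `(ℂ \ [1, ∞)) ∩ (ℂ \ (-∞, 0])`, in particular on `ℍₒ` and
near every point of `(0, 1)`. [folklore] -/
theorem differentiableOn_scFun : DifferentiableOn ℂ scFun (scDomain ∩ slitPlane) :=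
  DifferentiableOn.mul (fun _ hw => (differentiableAt_id.cpow_const hw.2).differentiableWithinAt)
    (differentiableOn_scAux.mono inter_subset_left)

/-- `ℍₒ ⊆ (ℂ \ [1, ∞)) ∩ (ℂ \ (-∞, 0])`. [folklore] -/
theorem upperHalfPlaneSet_subset_scDomain_inter_slitPlane :
    upperHalfPlaneSet ⊆ scDomain ∩ slitPlane :=
  fun _ hw => ⟨upperHalfPlaneSet_subset_scDomain hw, Or.inr (ne_of_gt hw)⟩

/-- `S` is holomorphic on `ℍₒ`. [folklore] -/
theorem differentiableOn_scFun_upperHalfPlaneSet : DifferentiableOn ℂ scFun upperHalfPlaneSet :=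
  differentiableOn_scFun.mono upperHalfPlaneSet_subset_scDomain_inter_slitPlane

/-! ### The derivative `S'(w) = w^{-2/3} (1 - w)^{-2/3}` -/

/-- The primitive `g(s) = 3 s^{1/3} (1 - sw)^{-2/3}` in `s` of `k + 3w ∂k/∂w`, used to evaluate
`h(w) + 3w h'(w)` by the fundamental theorem of calculus. [folklore] -/
def scPrim (w : ℂ) (s : ℝ) : ℂ :=
  3 * (((s ^ (1 / 3 : ℝ)) : ℝ) : ℂ) * (1 - (s : ℂ) * w) ^ (-(2 / 3 : ℂ))

/-- `∂g/∂s = k + 3w ∂k/∂w` on `(0, 1)`. [folklore] -/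
theorem hasDerivAt_scPrim {w : ℂ} (hw : w ∈ scDomain) {s : ℝ} (hs : s ∈ Ioo (0 : ℝ) 1) :
    HasDerivAt (scPrim w) (scKernel w s + 3 * w * scKernelDeriv w s) s := by
  have h1 : HasDerivAt (fun s : ℝ => (((s ^ (1 / 3 : ℝ)) : ℝ) : ℂ))
      (((1 / 3 : ℝ) * s ^ ((1 / 3 : ℝ) - 1) : ℝ) : ℂ) s :=
    (Real.hasDerivAt_rpow_const (Or.inl hs.1.ne')).ofReal_comp
  have hi : HasDerivAt (fun s : ℝ => 1 - (s : ℂ) * w) (-w) s := by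
    have h0 : HasDerivAt (fun z : ℂ => 1 - z * w) (-(1 * w)) (s : ℂ) :=
      ((hasDerivAt_id (s : ℂ)).mul_const w).const_sub 1
    simpa using h0.comp_ofReal
  have h2 : HasDerivAt (fun s : ℝ => (1 - (s : ℂ) * w) ^ (-(2 / 3 : ℂ)))
      (-(2 / 3 : ℂ) * (1 - (s : ℂ) * w) ^ (-(2 / 3 : ℂ) - 1) * -w) s := by
    have := (Complex.hasStrictDerivAt_cpow_const (c := -(2 / 3 : ℂ))
      (one_sub_mul_mem_slitPlane hw ⟨hs.1.le, hs.2.le⟩)).hasDerivAt.comp s hi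
    simpa [Function.comp_def] using this
  have h := (h1.mul h2).const_mul (3 : ℂ)
  have hfun : scPrim w = fun s : ℝ =>
      3 * ((((s ^ (1 / 3 : ℝ)) : ℝ) : ℂ) * (1 - (s : ℂ) * w) ^ (-(2 / 3 : ℂ))) := by
    funext s; simp only [scPrim, mul_assoc]
  rw [hfun]
  refine h.congr_deriv ?_
  have e1 : (1 / 3 : ℝ) - 1 = -(2 / 3) := by norm_num
  have e2 : s ^ (1 / 3 : ℝ) = s ^ (-(2 / 3 : ℝ)) * s := by
    rw [← Real.rpow_add_one hs.1.ne']; norm_num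
  rw [e1, e2, scKernel, scKernelDeriv]
  push_cast
  ring

/-- `g` is continuous on `[0, 1]`. [folklore] -/
theorem continuousOn_scPrim {w : ℂ} (hw : w ∈ scDomain) : ContinuousOn (scPrim w) (Icc 0 1) := by
  intro s hs
  refine ContinuousAt.continuousWithinAt ?_
  unfold scPrim
  refine ContinuousAt.mul (ContinuousAt.mul continuousAt_const ?_) ?_
  · exact Complex.continuous_ofReal.continuousAt.comp
      (Real.continuousAt_rpow_const _ _ (Or.inr (by norm_num)))
  · exact ContinuousAt.cpow (by fun_prop) continuousAt_const (one_sub_mul_mem_slitPlane hw hs)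

/-- `g(0) = 0`. [folklore] -/
theorem scPrim_zero (w : ℂ) : scPrim w 0 = 0 := by
  simp [scPrim]

/-- `g(1) = 3 (1 - w)^{-2/3}`. [folklore] -/
theorem scPrim_one (w : ℂ) : scPrim w 1 = 3 * (1 - w) ^ (-(2 / 3 : ℂ)) := by
  simp [scPrim]

/-- **Integration by parts**: `h(w) + 3w h'(w) = 3 (1 - w)^{-2/3}` for `w ∈ ℂ \ [1, ∞)`. [folklore] -/
theorem scAux_add_integral_scKernelDeriv {w : ℂ} (hw : w ∈ scDomain) :
    scAux w + 3 * w * ∫ s in (0 : ℝ)..1, scKernelDeriv w s = 3 * (1 - w) ^ (-(2 / 3 : ℂ)) := by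
  have hi1 := intervalIntegrable_scKernel hw
  have hi2 : IntervalIntegrable (fun s => 3 * w * scKernelDeriv w s) volume 0 1 :=
    (intervalIntegrable_scKernelDeriv hw).const_mul _
  have hftc : ∫ s in (0 : ℝ)..1, (scKernel w s + 3 * w * scKernelDeriv w s) =
      scPrim w 1 - scPrim w 0 :=
    intervalIntegral.integral_eq_sub_of_hasDerivAt_of_le zero_le_one (continuousOn_scPrim hw)
      (fun s hs => hasDerivAt_scPrim hw hs) (hi1.add hi2)
  rw [intervalIntegral.integral_add hi1 hi2, intervalIntegral.integral_const_mul, scPrim_one,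
    scPrim_zero, sub_zero] at hftc
  rw [← hftc, scAux]

/-- **The Schwarz–Christoffel integrand.** `S = w^{1/3} h` has derivative
`S'(w) = w^{-2/3} (1 - w)^{-2/3}` on `(ℂ \ [1, ∞)) ∩ (ℂ \ (-∞, 0])` (Berenstein–Gay 1991, §2.8,
formula (∗) before Prop. 2.8.14, with `α₁ = α₂ = 1/3`). [cite: BerensteinGay1991, §2.8 Example (2)] -/
theorem hasDerivAt_scFun {w : ℂ} (hw : w ∈ scDomain) (hw' : w ∈ slitPlane) :
    HasDerivAt scFun (scDeriv w) w := by
  have hw0 : w ≠ 0 := slitPlane_ne_zero hw'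
  have h1 : HasDerivAt (fun w : ℂ => w ^ (1 / 3 : ℂ)) ((1 / 3 : ℂ) * w ^ ((1 / 3 : ℂ) - 1)) w :=
    (Complex.hasStrictDerivAt_cpow_const hw').hasDerivAt
  have h := h1.mul (hasDerivAt_scAux hw)
  have hfun : scFun = fun w : ℂ => w ^ (1 / 3 : ℂ) * scAux w := rfl
  rw [hfun]
  refine h.congr_deriv ?_
  have e1 : (1 / 3 : ℂ) - 1 = -(2 / 3) := by norm_num
  have e2 : w ^ (1 / 3 : ℂ) = w ^ (-(2 / 3 : ℂ)) * w := by
    conv_lhs => rw [show (1 / 3 : ℂ) = -(2 / 3) + 1 by norm_num, cpow_add _ _ hw0, cpow_one]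
  rw [e1, e2, scDeriv]
  calc (1 / 3 : ℂ) * w ^ (-(2 / 3 : ℂ)) * scAux w
        + w ^ (-(2 / 3 : ℂ)) * w * ∫ s in (0 : ℝ)..1, scKernelDeriv w s
      = (1 / 3 : ℂ) * w ^ (-(2 / 3 : ℂ)) *
          (scAux w + 3 * w * ∫ s in (0 : ℝ)..1, scKernelDeriv w s) := by ring
    _ = w ^ (-(2 / 3 : ℂ)) * (1 - w) ^ (-(2 / 3 : ℂ)) := by
      rw [scAux_add_integral_scKernelDeriv hw]; ring

/-- `S' = scDeriv` on `ℍₒ`. [folklore] -/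
theorem hasDerivAt_scFun_of_mem {w : ℂ} (hw : w ∈ upperHalfPlaneSet) :
    HasDerivAt scFun (scDeriv w) w :=
  hasDerivAt_scFun (upperHalfPlaneSet_subset_scDomain hw) (Or.inr (ne_of_gt hw))

/-- `S'(w) ≠ 0` on `(ℂ \ [1, ∞)) ∩ (ℂ \ (-∞, 0])`. [folklore] -/
theorem scDeriv_ne_zero {w : ℂ} (hw : w ∈ scDomain) (hw' : w ∈ slitPlane) : scDeriv w ≠ 0 := by
  have h1 : (1 : ℂ) - w ≠ 0 :=
    slitPlane_ne_zero (by simpa using one_sub_mul_mem_slitPlane hw ⟨zero_le_one, le_rfl⟩)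
  simp [scDeriv, cpow_eq_zero_iff, slitPlane_ne_zero hw', h1]

/-! ### `S = schwarzTriangleMap` on `ℍₒ` -/

/-- Points of `ℍₒ` are non-zero. [folklore] -/
theorem ne_zero_of_mem_upperHalfPlaneSet {w : ℂ} (hw : w ∈ upperHalfPlaneSet) : w ≠ 0 := by
  rintro rfl; simp [upperHalfPlaneSet] at hw

/-- `(s w)^{-2/3} = s^{-2/3} w^{-2/3}` for real `s > 0` and `w ≠ 0` (principal branch:
`arg (s w) = arg w`). [folklore] -/
theorem ofReal_mul_cpow_neg_two_thirds {s : ℝ} (hs : 0 < s) {w : ℂ} (hw : w ≠ 0) :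
    ((s : ℂ) * w) ^ (-(2 / 3 : ℂ)) = ((s ^ (-(2 / 3 : ℝ)) : ℝ) : ℂ) * w ^ (-(2 / 3 : ℂ)) := by
  have hs0 : (s : ℂ) ≠ 0 := ofReal_ne_zero.2 hs.ne'
  rw [cpow_def_of_ne_zero (mul_ne_zero hs0 hw), log_ofReal_mul hs hw, add_mul, Complex.exp_add,
    cpow_def_of_ne_zero hw, ofReal_cpow hs.le, cpow_def_of_ne_zero hs0, (ofReal_log hs.le).symm]
  push_cast
  ring_nf

/-- `w^{1/3} = w^{-2/3} · w` for `w ≠ 0`. [folklore] -/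
theorem cpow_one_third_eq {w : ℂ} (hw : w ≠ 0) : w ^ (1 / 3 : ℂ) = w ^ (-(2 / 3 : ℂ)) * w := by
  conv_lhs => rw [show (1 / 3 : ℂ) = -(2 / 3) + 1 by norm_num, cpow_add _ _ hw, cpow_one]

/-- On `ℍₒ` the segment form `schwarzTriangleMap` and the factored form `scFun` of the
Schwarz–Christoffel integral agree: `w ∫_0^1 (sw)^{-2/3}(1-sw)^{-2/3} ds = w^{1/3} h(w)`. [folklore] -/
theorem schwarzTriangleMap_eq_scFun {w : ℂ} (hw : w ∈ upperHalfPlaneSet) :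
    schwarzTriangleMap w = scFun w := by
  have hw0 : w ≠ 0 := ne_zero_of_mem_upperHalfPlaneSet hw
  have hI : ∫ s in (0 : ℝ)..1, ((s : ℂ) * w) ^ (-(2 / 3 : ℂ)) * (1 - (s : ℂ) * w) ^ (-(2 / 3 : ℂ)) =
      ∫ s in (0 : ℝ)..1, w ^ (-(2 / 3 : ℂ)) * scKernel w s := by
    refine intervalIntegral.integral_congr_Ioo_of_le zero_le_one fun s hs => ?_
    simp only [scKernel]
    rw [ofReal_mul_cpow_neg_two_thirds hs.1 hw0]
    ring
  rw [schwarzTriangleMap, hI, intervalIntegral.integral_const_mul, scFun, scAux,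
    cpow_one_third_eq hw0]
  ring

/-! ### Real boundary values on `[0, 1)`: `S(u) = B(u; 1/3, 1/3)` -/

/-- `S(0) = 0`. [folklore] -/
theorem scFun_zero : scFun 0 = 0 := by
  simp [scFun]

/-- `S` is continuous at `0` (the singularity `t^{-2/3}` is integrable). [folklore] -/
theorem continuousAt_scFun_zero : ContinuousAt scFun 0 := by
  have h1 : ContinuousAt (fun w : ℂ => w ^ (1 / 3 : ℂ)) 0 :=
    continuousAt_cpow_const_of_re_pos (Or.inl le_rfl) (by norm_num)
  have h2 : ContinuousAt scAux 0 :=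
    continuousOn_scAux.continuousAt (isOpen_scDomain.mem_nhds (Or.inr (by simp)))
  exact h1.mul h2

/-- For real `u ∈ [0, 1)` and `s ∈ (0, 1]` the kernel is real:
`k(u, s) = s^{-2/3} (1 - su)^{-2/3}`. [folklore] -/
theorem scKernel_ofReal {u : ℝ} (hu0 : 0 ≤ u) (hu : u < 1) {s : ℝ} (hs : s ∈ Ioc (0 : ℝ) 1) :
    scKernel u s = ((s ^ (-(2 / 3 : ℝ)) * (1 - s * u) ^ (-(2 / 3 : ℝ)) : ℝ) : ℂ) := by
  have h1 : 0 ≤ 1 - s * u := by nlinarith [hs.1, hs.2]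
  rw [scKernel, neg_two_thirds_eq_cast, ofReal_mul, ofReal_cpow h1]
  push_cast
  ring_nf

/-- For real `u ∈ [0, 1)`, `h(u) = ∫_0^1 s^{-2/3}(1 - su)^{-2/3} ds` is a real integral. [folklore] -/
theorem scAux_ofReal {u : ℝ} (hu0 : 0 ≤ u) (hu : u < 1) :
    scAux u = ((∫ s in (0 : ℝ)..1, s ^ (-(2 / 3 : ℝ)) * (1 - s * u) ^ (-(2 / 3 : ℝ)) : ℝ) : ℂ) := by
  rw [scAux, ← intervalIntegral.integral_ofReal]
  refine intervalIntegral.integral_congr_Ioo_of_le zero_le_one fun s hs => ?_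
  rw [scKernel_ofReal hu0 hu ⟨hs.1, hs.2.le⟩]

/-- **Real boundary values.** For `u ∈ [0, 1)`: `S(u) = B(u; 1/3, 1/3) = incBeta13 u`
(substitution `t = su` in `∫_0^u (t(1-t))^{-2/3} dt`). [folklore] -/
theorem scFun_ofReal {u : ℝ} (hu0 : 0 ≤ u) (hu : u < 1) : scFun u = incBeta13 u := by
  rcases eq_or_lt_of_le hu0 with rfl | hu0'
  · simpa [incBeta13_zero] using scFun_zero
  have hcpow : ((u : ℂ) ^ (1 / 3 : ℂ)) = ((u ^ (1 / 3 : ℝ) : ℝ) : ℂ) := by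
    rw [ofReal_cpow hu0]; push_cast; ring_nf
  rw [scFun, scAux_ofReal hu0 hu, hcpow, ← ofReal_mul]
  congr 1
  have hsub : u * ∫ s in (0 : ℝ)..1, betaKernel13 (u * s) = ∫ t in (0 : ℝ)..u, betaKernel13 t := by
    rw [intervalIntegral.mul_integral_comp_mul_left, mul_zero, mul_one]
  have hker : ∫ s in (0 : ℝ)..1, betaKernel13 (u * s) =
      ∫ s in (0 : ℝ)..1, u ^ (-(2 / 3 : ℝ)) * (s ^ (-(2 / 3 : ℝ)) * (1 - s * u) ^ (-(2 / 3 : ℝ))) := by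
    refine intervalIntegral.integral_congr_Ioo_of_le zero_le_one fun s hs => ?_
    have h1 : 0 ≤ 1 - u * s := by nlinarith [hs.1, hs.2]
    simp only [betaKernel13]
    rw [Real.mul_rpow (mul_nonneg hu0 hs.1.le) h1, Real.mul_rpow hu0 hs.1.le, mul_comm u s]
    ring
  rw [incBeta13, ← hsub, hker, intervalIntegral.integral_const_mul, ← mul_assoc,
    ← Real.rpow_one_add' hu0 (by norm_num)]
  norm_num

/-! ### The reflection `w ↦ 1 - w`: `S(w) + S(1 - w) = B(1/3, 1/3)` and the boundary value at `1` -/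

/-- The domain of holomorphy `D = (ℂ \ [1, ∞)) ∩ (ℂ \ (-∞, 0]) = ℂ \ ((-∞, 0] ∪ [1, ∞))` of `S`
is symmetric under `w ↦ 1 - w`. [folklore] -/
theorem one_sub_mem_scDomain_inter_slitPlane {w : ℂ} (hw : w ∈ scDomain ∩ slitPlane) :
    1 - w ∈ scDomain ∩ slitPlane := by
  obtain ⟨h1, h2⟩ := hw
  rw [mem_slitPlane_iff] at h2
  simp only [scDomain, mem_setOf_eq] at h1
  refine ⟨?_, ?_⟩
  · simp only [scDomain, mem_setOf_eq, sub_im, one_im, zero_sub, ne_eq, neg_eq_zero, sub_re, one_re]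
    by_cases him : w.im = 0
    · right
      have : 0 < w.re := by tauto
      linarith
    · left; exact him
  · rw [mem_slitPlane_iff]
    simp only [sub_re, one_re, sub_im, one_im, zero_sub, ne_eq, neg_eq_zero, sub_pos]
    by_cases him : w.im = 0
    · left; tauto
    · right; exact him

/-- `D` is open. [folklore] -/
theorem isOpen_scDomain_inter_slitPlane : IsOpen (scDomain ∩ slitPlane) :=
  isOpen_scDomain.inter isOpen_slitPlane

/-- `D` is star-convex with respect to `1/2`, hence connected. [folklore] -/
theorem starConvex_scDomain_inter_slitPlane :
    StarConvex ℝ ((1 / 2 : ℝ) : ℂ) (scDomain ∩ slitPlane) := by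
  intro y hy a b ha hb hab
  obtain ⟨h1, h2⟩ := hy
  rw [mem_slitPlane_iff] at h2
  simp only [scDomain, mem_setOf_eq] at h1
  constructor
  · simp only [scDomain, mem_setOf_eq, add_im, smul_im, ofReal_im, smul_eq_mul, mul_zero, zero_add,
      add_re, smul_re, ofReal_re, ne_eq, mul_eq_zero, not_or]
    by_cases hb0 : b = 0
    · right; subst hb0; simp at hab; subst hab; norm_num
    · by_cases him : y.im = 0
      · right
        have hre1 : y.re < 1 := by tauto
        have hbpos : 0 < b := lt_of_le_of_ne hb (Ne.symm hb0)
        nlinarith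
      · left; exact ⟨hb0, him⟩
  · rw [mem_slitPlane_iff]
    simp only [add_re, smul_re, ofReal_re, smul_eq_mul, add_im, smul_im, ofReal_im, mul_zero,
      zero_add, ne_eq, mul_eq_zero, not_or]
    by_cases hb0 : b = 0
    · left; subst hb0; simp at hab; subst hab; norm_num
    · by_cases him : y.im = 0
      · left
        have hre0 : 0 < y.re := by tauto
        have hbpos : 0 < b := lt_of_le_of_ne hb (Ne.symm hb0)
        nlinarith
      · right; exact ⟨hb0, him⟩

/-- `D` is preconnected. [folklore] -/
theorem isPreconnected_scDomain_inter_slitPlane : IsPreconnected (scDomain ∩ slitPlane) :=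
  (starConvex_scDomain_inter_slitPlane.isPathConnected
    ⟨Or.inr (by simp; norm_num), Or.inl (by simp)⟩).isConnected.isPreconnected

/-- `S'(1 - w) = S'(w)`. [folklore] -/
theorem scDeriv_one_sub (w : ℂ) : scDeriv (1 - w) = scDeriv w := by
  rw [scDeriv, scDeriv, sub_sub_cancel, mul_comm]

/-- **Reflection identity**: `S(w) + S(1 - w)` is constant on `D`, equal to its value
`2 S(1/2)` at the centre of symmetry. [folklore] -/
theorem scFun_add_scFun_one_sub {w : ℂ} (hw : w ∈ scDomain ∩ slitPlane) :
    scFun w + scFun (1 - w) = 2 * scFun ((1 / 2 : ℝ) : ℂ) := by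
  have hderiv : ∀ z ∈ scDomain ∩ slitPlane,
      HasDerivAt (fun z => scFun z + scFun (1 - z)) 0 z := by
    intro z hz
    have hz' := one_sub_mem_scDomain_inter_slitPlane hz
    have h1 := hasDerivAt_scFun hz.1 hz.2
    have h2 : HasDerivAt (fun z => scFun (1 - z)) (scDeriv (1 - z) * -1) z :=
      (hasDerivAt_scFun hz'.1 hz'.2).comp z ((hasDerivAt_id z).const_sub 1)
    have h := h1.add h2
    rwa [scDeriv_one_sub, mul_neg_one, add_neg_cancel] at h
  have hhalf : ((1 / 2 : ℝ) : ℂ) ∈ scDomain ∩ slitPlane := ⟨Or.inr (by simp; norm_num), Or.inl (by simp)⟩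
  have key := isOpen_scDomain_inter_slitPlane.is_const_of_deriv_eq_zero
    isPreconnected_scDomain_inter_slitPlane
    (fun z hz => (hderiv z hz).differentiableAt.differentiableWithinAt)
    (fun z hz => (hderiv z hz).deriv) hw hhalf
  rw [key]
  have : (1 : ℂ) - ((1 / 2 : ℝ) : ℂ) = ((1 / 2 : ℝ) : ℂ) := by push_cast; norm_num
  rw [this]; ring

/-- `2 S(1/2) = B(1/3, 1/3)`: `S(1/2) = B(1/2; 1/3, 1/3)` and `B(1 - u) = B(1) - B(u)`. [folklore] -/
theorem two_mul_scFun_half : 2 * scFun ((1 / 2 : ℝ) : ℂ) = incBeta13 1 := by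
  rw [scFun_ofReal (by norm_num) (by norm_num)]
  have h := incBeta13_one_sub (u := 1 / 2) (by norm_num)
  norm_num at h
  have : incBeta13 1 = 2 * incBeta13 (1 / 2) := by linarith
  rw [this]; push_cast; ring

/-- `S(w) + S(1 - w) = B(1/3, 1/3)` on `D` (in particular on `ℍₒ`). [folklore] -/
theorem scFun_add_scFun_one_sub_eq {w : ℂ} (hw : w ∈ scDomain ∩ slitPlane) :
    scFun w + scFun (1 - w) = incBeta13 1 := by
  rw [scFun_add_scFun_one_sub hw, two_mul_scFun_half]

/-- **Boundary value at `1`.** `S(w) → B(1/3, 1/3)` as `w → 1` within `D ⊇ ℍₒ` (from the reflection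
identity and continuity of `S` at `0`). [folklore] -/
theorem tendsto_scFun_one :
    Tendsto scFun (𝓝[scDomain ∩ slitPlane] 1) (𝓝 (incBeta13 1 : ℂ)) := by
  have h1 : Tendsto (fun w : ℂ => 1 - w) (𝓝[scDomain ∩ slitPlane] 1) (𝓝 0) := by
    have : Tendsto (fun w : ℂ => 1 - w) (𝓝 1) (𝓝 (1 - 1)) :=
      ((continuous_const.sub continuous_id).tendsto 1)
    rw [sub_self] at this
    exact this.mono_left nhdsWithin_le_nhds
  have h2 : Tendsto (fun w => scFun (1 - w)) (𝓝[scDomain ∩ slitPlane] 1) (𝓝 0) := by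
    have := continuousAt_scFun_zero.tendsto.comp h1
    rwa [scFun_zero] at this
  have h3 : Tendsto (fun w => (incBeta13 1 : ℂ) - scFun (1 - w)) (𝓝[scDomain ∩ slitPlane] 1)
      (𝓝 ((incBeta13 1 : ℂ) - 0)) := tendsto_const_nhds.sub h2
  rw [sub_zero] at h3
  refine h3.congr' ?_
  filter_upwards [self_mem_nhdsWithin] with w hw
  rw [← scFun_add_scFun_one_sub_eq hw]; ring

/-- `S(w) → B(1/3, 1/3)` as `w → 1` within `ℍₒ`. [folklore] -/
theorem tendsto_scFun_one_upperHalfPlaneSet :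
    Tendsto scFun (𝓝[upperHalfPlaneSet] 1) (𝓝 (incBeta13 1 : ℂ)) :=
  tendsto_scFun_one.mono_left (nhdsWithin_mono _ upperHalfPlaneSet_subset_scDomain_inter_slitPlane)

/-- `S(w) → 0` as `w → 0` within `ℍₒ`. [folklore] -/
theorem tendsto_scFun_zero_upperHalfPlaneSet :
    Tendsto scFun (𝓝[upperHalfPlaneSet] 0) (𝓝 0) := by
  simpa [scFun_zero] using continuousAt_scFun_zero.tendsto.mono_left nhdsWithin_le_nhds

/-- `S(w) → B(u; 1/3, 1/3)` as `w → u ∈ (0, 1)` within `ℍₒ` (`S` is holomorphic near `u`). [folklore] -/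
theorem tendsto_scFun_ofReal_upperHalfPlaneSet {u : ℝ} (hu : u ∈ Ioo (0 : ℝ) 1) :
    Tendsto scFun (𝓝[upperHalfPlaneSet] u) (𝓝 (incBeta13 u : ℂ)) := by
  have hmem : (u : ℂ) ∈ scDomain ∩ slitPlane := ⟨ofReal_mem_scDomain hu.2, Or.inl (by simpa using hu.1)⟩
  have hc : ContinuousAt scFun u := (hasDerivAt_scFun hmem.1 hmem.2).continuousAt
  rw [← scFun_ofReal hu.1.le hu.2]
  exact hc.tendsto.mono_left nhdsWithin_le_nhds

/-- Boundary values on `[0, 1]` collected: `S(w) → B(u; 1/3, 1/3)` as `w → u` within `ℍₒ`. [folklore] -/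
theorem tendsto_scFun_of_mem_Icc {u : ℝ} (hu : u ∈ Icc (0 : ℝ) 1) :
    Tendsto scFun (𝓝[upperHalfPlaneSet] u) (𝓝 (incBeta13 u : ℂ)) := by
  rcases eq_or_lt_of_le hu.1 with rfl | hu0
  · simpa [incBeta13_zero] using tendsto_scFun_zero_upperHalfPlaneSet
  rcases eq_or_lt_of_le hu.2 with rfl | hu1
  · simpa using tendsto_scFun_one_upperHalfPlaneSet
  exact tendsto_scFun_ofReal_upperHalfPlaneSet ⟨hu0, hu1⟩

/-! ### An angle estimate: `arg w + |arg (1 - sw)| < π` on `ℍₒ` -/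

/-- For `z ∈ ℍₒ`, `arg z < arg (z - 1)` (the point `z - 1` lies to the left of `z` at the same
height; proof: `sin (arg (z-1) - arg z) = im z / (|z| |z-1|) > 0`). [folklore] -/
theorem arg_lt_arg_sub_one {z : ℂ} (hz : 0 < z.im) : arg z < arg (z - 1) := by
  have hz0 : z ≠ 0 := ne_zero_of_mem_upperHalfPlaneSet hz
  have hz1im : 0 < (z - 1).im := by simpa using hz
  have hz1 : z - 1 ≠ 0 := ne_zero_of_mem_upperHalfPlaneSet hz1im
  have ha0 : 0 ≤ arg z := arg_nonneg_iff.2 hz.le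
  have ha1 : arg (z - 1) < π := arg_lt_pi_iff.2 (Or.inr hz1im.ne')
  have hsin : Real.sin (arg (z - 1) - arg z) = z.im / (‖z - 1‖ * ‖z‖) := by
    rw [Real.sin_sub, sin_arg, cos_arg hz0, cos_arg hz1, sin_arg]
    have h1 : ‖z - 1‖ ≠ 0 := norm_ne_zero_iff.2 hz1
    have h2 : ‖z‖ ≠ 0 := norm_ne_zero_iff.2 hz0
    field_simp
    simp; ring
  have hpos : 0 < Real.sin (arg (z - 1) - arg z) := by
    rw [hsin]; positivity
  by_contra hle
  push Not at hle
  have : Real.sin (arg (z - 1) - arg z) ≤ 0 :=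
    Real.sin_nonpos_of_nonpos_of_neg_pi_le (by linarith)
      (by linarith [arg_le_pi z, arg_nonneg_iff.2 hz1im.le])
  linarith

/-- For `w ∈ ℍₒ` and real `s > 0`: `1 - sw` lies in the lower half-plane, and its argument
`-β ∈ (-π, 0)` satisfies `arg w + β < π` (the angles at `0` and `1/s` of the triangle
`0, 1/s, w`). [folklore] -/
theorem arg_add_neg_arg_one_sub_mul_lt_pi {w : ℂ} (hw : 0 < w.im) {s : ℝ} (hs : 0 < s) :
    arg w + -arg (1 - (s : ℂ) * w) < π := by
  have hz : 0 < ((s : ℂ) * w).im := by simpa using mul_pos hs hw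
  have h1 : 1 - (s : ℂ) * w = -((s : ℂ) * w - 1) := by ring
  rw [h1, arg_neg_eq_arg_sub_pi_of_im_pos (by simpa using hz), ← arg_real_mul w hs]
  linarith [arg_lt_arg_sub_one hz]

/-- For `w ∈ ℍₒ` and real `s > 0`, `arg (1 - sw) < 0`. [folklore] -/
theorem arg_one_sub_mul_neg {w : ℂ} (hw : 0 < w.im) {s : ℝ} (hs : 0 < s) :
    arg (1 - (s : ℂ) * w) < 0 :=
  arg_neg_iff.2 (by simpa using mul_pos hs hw)

/-! ### The direction of `S'`: the key positivity estimates -/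

/-- The quantity `P(w, s) = w^{1/3} (1 - sw)^{-2/3}`; `S'(w) w = P(w, 1)` and
`S(w) = ∫_0^1 s^{-2/3} P(w, s) ds`. [folklore] -/
def scP (w : ℂ) (s : ℝ) : ℂ := w ^ (1 / 3 : ℂ) * (1 - (s : ℂ) * w) ^ (-(2 / 3 : ℂ))

/-- The logarithm `Λ = (1/3) log w - (2/3) log (1 - sw)` of `P(w, s)`. [folklore] -/
def scLogP (w : ℂ) (s : ℝ) : ℂ := log w * (1 / 3 : ℂ) + log (1 - (s : ℂ) * w) * (-(2 / 3 : ℂ))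

/-- `P = exp Λ` for `w ≠ 0`, `1 - sw ≠ 0`. [folklore] -/
theorem scP_eq_exp {w : ℂ} (hw : w ≠ 0) {s : ℝ} (hs : 1 - (s : ℂ) * w ≠ 0) :
    scP w s = exp (scLogP w s) := by
  rw [scP, scLogP, Complex.exp_add, cpow_def_of_ne_zero hw, cpow_def_of_ne_zero hs]

/-- The imaginary part of `Λ` is `(arg w + 2β)/3` with `β = -arg (1 - sw)`. [folklore] -/
theorem scLogP_im (w : ℂ) (s : ℝ) :
    (scLogP w s).im = (arg w + 2 * -arg (1 - (s : ℂ) * w)) / 3 := by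
  simp only [scLogP, add_im, mul_im, log_im, log_re, one_div]
  norm_num
  ring

/-- **Angle bound.** For `w ∈ ℍₒ`, `s > 0`: `0 < Im Λ < 2π/3`, i.e. `arg P(w, s) ∈ (0, 2π/3)`. [folklore] -/
theorem scLogP_im_mem {w : ℂ} (hw : 0 < w.im) {s : ℝ} (hs : 0 < s) :
    (scLogP w s).im ∈ Ioo 0 (2 * π / 3) := by
  rw [scLogP_im]
  have h1 : 0 < arg w := by
    rcases (arg_nonneg_iff.2 hw.le).eq_or_lt with h | h
    · exact absurd h.symm (fun h0 => by rw [arg_eq_zero_iff] at h0; exact hw.ne' h0.2)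
    · exact h
  have h2 := arg_one_sub_mul_neg hw hs
  have h3 := arg_add_neg_arg_one_sub_mul_lt_pi hw hs
  have h4 : -arg (1 - (s : ℂ) * w) ≤ π := by linarith [neg_pi_lt_arg (1 - (s : ℂ) * w)]
  constructor
  · linarith
  · linarith

/-- `1 - sw ≠ 0` for `w ∈ ℍₒ`, `s > 0`. [folklore] -/
theorem one_sub_mul_ne_zero {w : ℂ} (hw : 0 < w.im) {s : ℝ} (hs : 0 < s) : 1 - (s : ℂ) * w ≠ 0 := by
  intro h
  have := congrArg Complex.im h
  simp at this
  rcases this with h0 | h0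
  · exact hs.ne' h0
  · exact hw.ne' h0

/-- `Im P(w, s) > 0` for `w ∈ ℍₒ`, `s > 0`. [folklore] -/
theorem scP_im_pos {w : ℂ} (hw : 0 < w.im) {s : ℝ} (hs : 0 < s) : 0 < (scP w s).im := by
  have hw0 : w ≠ 0 := ne_zero_of_mem_upperHalfPlaneSet hw
  have hs' := one_sub_mul_ne_zero hw hs
  rw [scP_eq_exp hw0 hs', exp_im]
  obtain ⟨h1, h2⟩ := scLogP_im_mem hw hs
  exact mul_pos (Real.exp_pos _) (Real.sin_pos_of_pos_of_lt_pi h1 (by linarith [Real.pi_pos]))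

/-- The unit vector `e^{-iπ/3}` (direction in which `S'(w) w` has positive component). [folklore] -/
def scDir : ℂ := exp (-(π / 3 : ℝ) * I)

/-- `Re (e^{-iπ/3} P(w, s)) > 0` for `w ∈ ℍₒ`, `s > 0`. [folklore] -/
theorem scDir_mul_scP_re_pos {w : ℂ} (hw : 0 < w.im) {s : ℝ} (hs : 0 < s) :
    0 < (scDir * scP w s).re := by
  have hw0 : w ≠ 0 := ne_zero_of_mem_upperHalfPlaneSet hw
  have hs' := one_sub_mul_ne_zero hw hs
  rw [scP_eq_exp hw0 hs', scDir, ← Complex.exp_add, exp_re]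
  refine mul_pos (Real.exp_pos _) (Real.cos_pos_of_mem_Ioo ?_)
  obtain ⟨h1, h2⟩ := scLogP_im_mem hw hs
  simp only [add_im, mul_im, neg_re, ofReal_re, I_im, mul_one, neg_im, ofReal_im, neg_zero, I_re,
    mul_zero, add_zero]
  constructor <;> linarith [Real.pi_pos]

/-! ### `Im S > 0` on `ℍₒ` -/

/-- `w^{1/3} k(w, s) = s^{-2/3} P(w, s)`. [folklore] -/
theorem cpow_mul_scKernel (w : ℂ) (s : ℝ) :
    w ^ (1 / 3 : ℂ) * scKernel w s = ((s ^ (-(2 / 3 : ℝ)) : ℝ) : ℂ) * scP w s := by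
  simp only [scKernel, scP]; ring

/-- **`S` maps `ℍₒ` into `ℍₒ`**: `Im S(w) = ∫_0^1 s^{-2/3} Im P(w, s) ds > 0`. [folklore] -/
theorem scFun_im_pos {w : ℂ} (hw : 0 < w.im) : 0 < (scFun w).im := by
  have hwD : w ∈ scDomain := upperHalfPlaneSet_subset_scDomain hw
  have hint : IntervalIntegrable (fun s => w ^ (1 / 3 : ℂ) * scKernel w s) volume 0 1 :=
    (intervalIntegrable_scKernel hwD).const_mul _
  have h1 : scFun w = ∫ s in (0 : ℝ)..1, w ^ (1 / 3 : ℂ) * scKernel w s := by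
    rw [scFun, scAux, intervalIntegral.integral_const_mul]
  have h2 : (scFun w).im = ∫ s in (0 : ℝ)..1, (w ^ (1 / 3 : ℂ) * scKernel w s).im := by
    rw [h1]
    have := intervalIntegral.intervalIntegral_im hint
    simpa using this.symm
  rw [h2]
  refine intervalIntegral.intervalIntegral_pos_of_pos_on ?_ (fun s hs => ?_) zero_lt_one
  · have : IntervalIntegrable (fun s => Complex.imCLM (w ^ (1 / 3 : ℂ) * scKernel w s)) volume 0 1 :=
      ⟨Complex.imCLM.integrable_comp hint.1, Complex.imCLM.integrable_comp hint.2⟩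
    simpa using this
  · rw [cpow_mul_scKernel, im_ofReal_mul]
    exact mul_pos (Real.rpow_pos_of_pos hs.1 _) (scP_im_pos hw hs.1)

/-! ### Injectivity of `S` on `ℍₒ` (Noshiro–Warschawski on the strip `log ℍₒ`) -/

/-- The strip `Ω = {0 < Im ζ < π}`, mapped by `exp` bijectively onto `ℍₒ` (inverse `log`). [folklore] -/
def scStrip : Set ℂ := {ζ : ℂ | 0 < ζ.im ∧ ζ.im < π}

/-- `exp Ω ⊆ ℍₒ`. [folklore] -/
theorem exp_mem_upperHalfPlaneSet {ζ : ℂ} (hζ : ζ ∈ scStrip) : exp ζ ∈ upperHalfPlaneSet := by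
  show 0 < (exp ζ).im
  rw [exp_im]
  exact mul_pos (Real.exp_pos _) (Real.sin_pos_of_pos_of_lt_pi hζ.1 hζ.2)

/-- `0 < arg w` for `w ∈ ℍₒ`. [folklore] -/
theorem arg_pos_of_im_pos {w : ℂ} (hw : 0 < w.im) : 0 < arg w := by
  rcases (arg_nonneg_iff.2 hw.le).eq_or_lt with h | h
  · exact absurd h.symm (fun h0 => by rw [arg_eq_zero_iff] at h0; exact hw.ne' h0.2)
  · exact h

/-- `log ℍₒ ⊆ Ω`. [folklore] -/
theorem log_mem_scStrip {w : ℂ} (hw : 0 < w.im) : log w ∈ scStrip :=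
  ⟨by rw [log_im]; exact arg_pos_of_im_pos hw, by rw [log_im]; exact arg_lt_pi_iff.2 (Or.inr hw.ne')⟩

/-- `S'(w) · w = P(w, 1)`. [folklore] -/
theorem scDeriv_mul_self {w : ℂ} (hw : w ≠ 0) : scDeriv w * w = scP w 1 := by
  rw [scDeriv, scP, cpow_one_third_eq hw]; push_cast; ring

/-- The derivative of `G = S ∘ exp` on `Ω` is `G'(ζ) = S'(e^ζ) e^ζ = P(e^ζ, 1)`. [folklore] -/
theorem hasDerivAt_scFun_exp {ζ : ℂ} (hζ : ζ ∈ scStrip) :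
    HasDerivAt (fun ζ => scFun (exp ζ)) (scP (exp ζ) 1) ζ := by
  have h := (hasDerivAt_scFun_of_mem (exp_mem_upperHalfPlaneSet hζ)).comp ζ (Complex.hasDerivAt_exp ζ)
  rw [scDeriv_mul_self (exp_ne_zero ζ)] at h
  exact h

/-- **Noshiro–Warschawski for `G = S ∘ exp`.** On the convex strip `Ω`, `Re (e^{-iπ/3} G') > 0`,
hence `G` is injective: along the segment from `ζ₁` to `ζ₂` the real function
`t ↦ Re (e^{-iπ/3} G(γ(t)) / (ζ₂ - ζ₁))` has positive derivative. [folklore] -/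
theorem scFun_exp_injOn : InjOn (fun ζ => scFun (exp ζ)) scStrip := by
  intro ζ₁ h₁ ζ₂ h₂ heq
  have heq' : scFun (exp ζ₁) = scFun (exp ζ₂) := heq
  by_contra hne
  set d : ℂ := ζ₂ - ζ₁ with hd
  have hd0 : d ≠ 0 := sub_ne_zero.2 (Ne.symm hne)
  set c : ℂ := scDir / d with hc
  have hγ : ∀ t ∈ Icc (0 : ℝ) 1, ζ₁ + (t : ℂ) * d ∈ scStrip := by
    intro t ht
    simp only [scStrip, mem_setOf_eq, add_im, mul_im, ofReal_re, ofReal_im, zero_mul, add_zero, hd,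
      sub_im]
    obtain ⟨a1, b1⟩ := h₁
    obtain ⟨a2, b2⟩ := h₂
    constructor
    · nlinarith [mul_nonneg (sub_nonneg.2 ht.2) (sub_nonneg.2 (min_le_left ζ₁.im ζ₂.im)),
        mul_nonneg ht.1 (sub_nonneg.2 (min_le_right ζ₁.im ζ₂.im)), lt_min a1 a2]
    · nlinarith [mul_nonneg (sub_nonneg.2 ht.2) (sub_nonneg.2 (le_max_left ζ₁.im ζ₂.im)),
        mul_nonneg ht.1 (sub_nonneg.2 (le_max_right ζ₁.im ζ₂.im)), max_lt b1 b2]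
  have hderiv : ∀ t ∈ Icc (0 : ℝ) 1,
      HasDerivAt (fun x : ℝ => (c * scFun (exp (ζ₁ + (x : ℂ) * d))).re)
        (scDir * scP (exp (ζ₁ + (t : ℂ) * d)) 1).re t := by
    intro t ht
    have hlin : HasDerivAt (fun z : ℂ => ζ₁ + z * d) d (t : ℂ) := by
      simpa using ((hasDerivAt_id (t : ℂ)).mul_const d).const_add ζ₁
    have hG := (hasDerivAt_scFun_exp (hγ t ht)).comp (t : ℂ) hlin
    have hf := hG.const_mul c
    have hval : c * (scP (exp (ζ₁ + (t : ℂ) * d)) 1 * d) = scDir * scP (exp (ζ₁ + (t : ℂ) * d)) 1 := by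
      rw [hc]; field_simp
    rw [hval] at hf
    exact hf.real_of_complex
  have hcont : ContinuousOn (fun x : ℝ => (c * scFun (exp (ζ₁ + (x : ℂ) * d))).re) (Icc 0 1) :=
    fun t ht => (hderiv t ht).continuousAt.continuousWithinAt
  have hmono := strictMonoOn_of_deriv_pos (convex_Icc 0 1) hcont (fun t ht => by
    rw [interior_Icc] at ht
    rw [(hderiv t ⟨ht.1.le, ht.2.le⟩).deriv]
    exact scDir_mul_scP_re_pos (exp_mem_upperHalfPlaneSet (hγ t ⟨ht.1.le, ht.2.le⟩)) one_pos)
  have hlt := hmono (left_mem_Icc.2 zero_le_one) (right_mem_Icc.2 zero_le_one) zero_lt_one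
  have e1 : ζ₁ + ((1 : ℝ) : ℂ) * d = ζ₂ := by rw [hd]; push_cast; ring
  have e0 : ζ₁ + ((0 : ℝ) : ℂ) * d = ζ₁ := by push_cast; ring
  simp only [e1, e0, heq'] at hlt
  exact lt_irrefl _ hlt

/-- **Injectivity of the Schwarz–Christoffel map on `ℍₒ`** (`S = G ∘ log`). [folklore] -/
theorem scFun_injOn : InjOn scFun upperHalfPlaneSet := by
  intro w₁ hw₁ w₂ hw₂ heq
  have h1 : exp (log w₁) = w₁ := exp_log (ne_zero_of_mem_upperHalfPlaneSet hw₁)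
  have h2 : exp (log w₂) = w₂ := exp_log (ne_zero_of_mem_upperHalfPlaneSet hw₂)
  have key := scFun_exp_injOn (log_mem_scStrip hw₁) (log_mem_scStrip hw₂)
    (show scFun (exp (log w₁)) = scFun (exp (log w₂)) by rw [h1, h2]; exact heq)
  rw [← h1, ← h2, key]

/-! ### The Möbius symmetry `w ↦ 1 - 1/w` (cyclic permutation `∞ ↦ 1 ↦ 0 ↦ ∞` of the vertices) -/

/-- `log (-x) = log x + πi` for `x` in the open lower half-plane. [folklore] -/
theorem log_neg_of_im_neg {x : ℂ} (hx : x.im < 0) : log (-x) = log x + π * I := by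
  refine Complex.ext ?_ ?_
  · simp [log_re]
  · simp [log_im, arg_neg_eq_arg_add_pi_of_im_neg hx]

/-- `(w - 1)^{-2/3} = e^{-2πi/3} (1 - w)^{-2/3}` for `w ∈ ℍₒ` (principal branches). [folklore] -/
theorem sub_one_cpow_of_im_pos {w : ℂ} (hw : 0 < w.im) :
    (w - 1) ^ (-(2 / 3 : ℂ)) = exp (-(2 / 3 : ℂ) * (π * I)) * (1 - w) ^ (-(2 / 3 : ℂ)) := by
  have him : (1 - w).im < 0 := by simpa using hw
  have hne : (1 : ℂ) - w ≠ 0 := fun h => by rw [h] at him; simp at him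
  have hne' : w - 1 ≠ 0 := fun h => hne (by rw [← neg_sub, h, neg_zero])
  rw [cpow_def_of_ne_zero hne', cpow_def_of_ne_zero hne, show w - 1 = -(1 - w) by ring,
    log_neg_of_im_neg him, add_mul, Complex.exp_add]
  ring

/-- `(x y)^c = x^c y^c` when `arg x + arg y ∈ (-π, π]`. [folklore] -/
theorem mul_cpow_of_arg {x y : ℂ} (hx : x ≠ 0) (hy : y ≠ 0) (h : arg x + arg y ∈ Ioc (-π) π)
    (c : ℂ) : (x * y) ^ c = x ^ c * y ^ c := by
  rw [cpow_def_of_ne_zero (mul_ne_zero hx hy), (log_mul_eq_add_log_iff hx hy).2 h, add_mul,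
    Complex.exp_add, ← cpow_def_of_ne_zero hx, ← cpow_def_of_ne_zero hy]

/-- `arg (w⁻¹) = -arg w` for `w ∈ ℍₒ`. [folklore] -/
theorem arg_inv_of_im_pos {w : ℂ} (hw : 0 < w.im) : arg w⁻¹ = -arg w := by
  rw [arg_inv, if_neg (arg_lt_pi_iff.2 (Or.inr hw.ne')).ne]

/-- `w ↦ 1 - 1/w` maps `ℍₒ` into itself. [folklore] -/
theorem one_sub_inv_mem {w : ℂ} (hw : w ∈ upperHalfPlaneSet) : 1 - w⁻¹ ∈ upperHalfPlaneSet := by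
  have hw' : (0 : ℝ) < w.im := hw
  show 0 < (1 - w⁻¹).im
  rw [sub_im, one_im, inv_im, zero_sub, neg_div, neg_neg]
  exact div_pos hw' (normSq_pos.2 (ne_zero_of_mem_upperHalfPlaneSet hw))

/-- `w ↦ (1 - w)⁻¹` (the inverse of `w ↦ 1 - 1/w`) maps `ℍₒ` into itself. [folklore] -/
theorem inv_one_sub_mem {w : ℂ} (hw : w ∈ upperHalfPlaneSet) : (1 - w)⁻¹ ∈ upperHalfPlaneSet := by
  have hw' : (0 : ℝ) < w.im := hw
  show 0 < ((1 - w)⁻¹).im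
  rw [inv_im]
  have h1 : (1 - w).im = -w.im := by simp
  rw [h1, neg_neg]
  refine div_pos hw' (normSq_pos.2 ?_)
  intro h; have := congrArg Complex.im h; simp at this; exact hw'.ne' this

/-- **Derivative bookkeeping for the symmetry**: `S'(1 - 1/w) · (1/w²) = e^{-2πi/3} S'(w)` on `ℍₒ`
(principal branches: `arg (w-1) + arg (1/w) ∈ (-π, π)`, `(w-1)^{-2/3} = e^{-2πi/3}(1-w)^{-2/3}`). [folklore] -/
theorem scDeriv_one_sub_inv {w : ℂ} (hw : 0 < w.im) :
    scDeriv (1 - w⁻¹) * (w ^ 2)⁻¹ = exp (-(2 / 3 : ℂ) * (π * I)) * scDeriv w := by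
  have hw0 : w ≠ 0 := ne_zero_of_mem_upperHalfPlaneSet hw
  have hargw : arg w ≠ π := (arg_lt_pi_iff.2 (Or.inr hw.ne')).ne
  have hw1im : 0 < (w - 1).im := by simpa using hw
  have hw1 : w - 1 ≠ 0 := ne_zero_of_mem_upperHalfPlaneSet hw1im
  have hfac : 1 - w⁻¹ = (w - 1) * w⁻¹ := by field_simp
  have harg : arg (w - 1) + arg w⁻¹ ∈ Ioc (-π) π := by
    rw [arg_inv_of_im_pos hw]
    constructor
    · linarith [arg_nonneg_iff.2 hw1im.le, arg_lt_pi_iff.2 (Or.inr hw.ne')]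
    · linarith [arg_le_pi (w - 1), arg_nonneg_iff.2 hw.le]
  have hinv : (w⁻¹) ^ (-(2 / 3 : ℂ)) = w ^ (2 / 3 : ℂ) := by
    rw [inv_cpow _ _ hargw, ← cpow_neg, neg_neg]
  rw [scDeriv, sub_sub_cancel, hfac, mul_cpow_of_arg hw1 (inv_ne_zero hw0) harg,
    sub_one_cpow_of_im_pos hw, hinv, scDeriv]
  have hpow : w ^ (2 / 3 : ℂ) * w ^ (2 / 3 : ℂ) * (w ^ 2)⁻¹ = w ^ (-(2 / 3 : ℂ)) := by
    rw [← cpow_add _ _ hw0, show (2 / 3 : ℂ) + 2 / 3 = -(2 / 3) + 2 by norm_num, cpow_add _ _ hw0,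
      cpow_two, mul_assoc, mul_inv_cancel₀ (pow_ne_zero 2 hw0), mul_one]
  calc exp (-(2 / 3 : ℂ) * (π * I)) * (1 - w) ^ (-(2 / 3 : ℂ)) * w ^ (2 / 3 : ℂ) * w ^ (2 / 3 : ℂ) *
        (w ^ 2)⁻¹
      = exp (-(2 / 3 : ℂ) * (π * I)) * (1 - w) ^ (-(2 / 3 : ℂ)) *
          (w ^ (2 / 3 : ℂ) * w ^ (2 / 3 : ℂ) * (w ^ 2)⁻¹) := by ring
    _ = _ := by rw [hpow]; ring

/-- The rotation `e^{-2πi/3} = -ζ` (`ζ = e^{iπ/3}` the apex). [folklore] -/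
theorem exp_neg_two_thirds_pi_mul_I : exp (-(2 / 3 : ℂ) * (π * I)) = -equilateralApex := by
  have h : -(2 / 3 : ℂ) * (π * I) = ((-(2 * π / 3) : ℝ) : ℂ) * I := by push_cast; ring
  rw [h, exp_mul_I, ← ofReal_cos, ← ofReal_sin, Real.cos_neg, Real.sin_neg,
    show 2 * π / 3 = π - π / 3 by ring, Real.cos_pi_sub, Real.sin_pi_sub, Real.cos_pi_div_three,
    Real.sin_pi_div_three]
  refine Complex.ext ?_ ?_ <;> simp

/-- **The Möbius symmetry of the Schwarz–Christoffel map**: for `w ∈ ℍₒ`,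
`S(1 - 1/w) = ζ (B(1/3,1/3) - S(w))`, `ζ = e^{iπ/3}`: the automorphism `w ↦ 1 - 1/w` of `ℍₒ`
(cyclically permuting `0 ↦ ∞ ↦ 1 ↦ 0`) corresponds to the rotation of the triangle by `-120°`
about its centre (both sides have derivative `-ζ S'(w)`; the constant is fixed by `w → 1`). [folklore] -/
theorem scFun_one_sub_inv {w : ℂ} (hw : w ∈ upperHalfPlaneSet) :
    scFun (1 - w⁻¹) = equilateralApex * (incBeta13 1 - scFun w) := by
  -- the difference `D w = S(1 - 1/w) + ζ S(w)` has zero derivative on `ℍₒ`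
  set D : ℂ → ℂ := fun w => scFun (1 - w⁻¹) + equilateralApex * scFun w with hD
  have hderiv : ∀ z ∈ upperHalfPlaneSet, HasDerivAt D 0 z := by
    intro z hz
    have hz' : (0 : ℝ) < z.im := hz
    have hz0 : z ≠ 0 := ne_zero_of_mem_upperHalfPlaneSet hz
    have hm : HasDerivAt (fun w : ℂ => 1 - w⁻¹) ((z ^ 2)⁻¹) z := by
      simpa using (hasDerivAt_inv hz0).const_sub (1 : ℂ)
    have hS := hasDerivAt_scFun_of_mem (one_sub_inv_mem hz)
    have h1 : HasDerivAt (fun w => scFun (1 - w⁻¹)) (scDeriv (1 - z⁻¹) * (z ^ 2)⁻¹) z := by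
      have h := hS.comp z hm
      exact h
    have h2 := (hasDerivAt_scFun_of_mem hz).const_mul equilateralApex
    have h := h1.add h2
    rw [scDeriv_one_sub_inv hz', exp_neg_two_thirds_pi_mul_I, neg_mul, neg_add_cancel] at h
    exact h
  have hopen : IsOpen upperHalfPlaneSet := isOpen_upperHalfPlaneSet
  have hconst : ∀ z ∈ upperHalfPlaneSet, D z = D w := fun z hz =>
    hopen.is_const_of_deriv_eq_zero (convex_halfSpace_im_gt 0).isPreconnected
      (fun z hz => (hderiv z hz).differentiableAt.differentiableWithinAt)
      (fun z hz => (hderiv z hz).deriv) hz hw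
  -- the constant is `ζ B(1/3,1/3)`: let `z → 1` within `ℍₒ`
  have hlim1 : Tendsto D (𝓝[upperHalfPlaneSet] 1) (𝓝 (0 + equilateralApex * incBeta13 1)) := by
    refine Tendsto.add ?_ (tendsto_scFun_one_upperHalfPlaneSet.const_mul _)
    have hm : Tendsto (fun w : ℂ => 1 - w⁻¹) (𝓝 (1 : ℂ)) (𝓝 0) := by
      have : ContinuousAt (fun w : ℂ => 1 - w⁻¹) 1 :=
        continuousAt_const.sub (continuousAt_inv₀ one_ne_zero)
      simpa using this.tendsto
    have := (continuousAt_scFun_zero.tendsto.comp hm).mono_left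
      (nhdsWithin_le_nhds (s := upperHalfPlaneSet))
    rwa [scFun_zero] at this
  have hlim2 : Tendsto D (𝓝[upperHalfPlaneSet] 1) (𝓝 (D w)) :=
    tendsto_const_nhds.congr' (eventually_mem_nhdsWithin.mono fun z hz => (hconst z hz).symm)
  haveI := neBot_nhdsWithin_upperHalfPlaneSet 1
  have heq : D w = 0 + equilateralApex * incBeta13 1 := by
    refine tendsto_nhds_unique hlim2 ?_
    simpa using hlim1
  simp only [hD, zero_add] at heq
  linear_combination heq

/-! ### Boundary values on `(-∞, 0)`, `(1, ∞)` and at `∞` -/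

/-- Transport of `S` along `n(w) = (1 - w)⁻¹`: `S(w) = ζ (B(1/3,1/3) - S((1 - w)⁻¹))` on `ℍₒ`. [folklore] -/
theorem scFun_eq_of_inv_one_sub {w : ℂ} (hw : w ∈ upperHalfPlaneSet) :
    scFun w = equilateralApex * (incBeta13 1 - scFun ((1 - w)⁻¹)) := by
  have h := scFun_one_sub_inv (inv_one_sub_mem hw)
  rwa [inv_inv, sub_sub_cancel] at h

/-- `n(w) = (1 - w)⁻¹ → (1 - v)⁻¹` within `ℍₒ` as `w → v ≠ 1` within `ℍₒ`. [folklore] -/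
theorem tendsto_inv_one_sub_nhdsWithin {v : ℂ} (hv : v ≠ 1) :
    Tendsto (fun w : ℂ => (1 - w)⁻¹) (𝓝[upperHalfPlaneSet] v) (𝓝[upperHalfPlaneSet] (1 - v)⁻¹) := by
  refine tendsto_nhdsWithin_of_tendsto_nhds_of_eventually_within _ ?_ ?_
  · exact ((continuousAt_const.sub continuousAt_id).inv₀ (sub_ne_zero.2 hv.symm)).tendsto.mono_left
      nhdsWithin_le_nhds
  · exact eventually_mem_nhdsWithin.mono fun w hw => inv_one_sub_mem hw

/-- `n(w) = (1 - w)⁻¹ → 0` within `ℍₒ` as `w → ∞` within `ℍₒ`. [folklore] -/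
theorem tendsto_inv_one_sub_atInfty :
    Tendsto (fun w : ℂ => (1 - w)⁻¹) (cocompact ℂ ⊓ 𝓟 upperHalfPlaneSet) (𝓝[upperHalfPlaneSet] 0) := by
  refine tendsto_nhdsWithin_of_tendsto_nhds_of_eventually_within _ ?_ ?_
  · refine Tendsto.mono_left ?_ inf_le_left
    rw [tendsto_zero_iff_norm_tendsto_zero]
    have h1 : Tendsto (fun w : ℂ => ‖w‖ - 1) (cocompact ℂ) atTop :=
      tendsto_atTop_add_const_right _ _ tendsto_norm_cocompact_atTop
    have h2 : Tendsto (fun w : ℂ => ‖1 - w‖) (cocompact ℂ) atTop :=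
      tendsto_atTop_mono (fun w => by
        have := norm_sub_norm_le w 1
        rw [norm_sub_rev] at this ⊢
        simp at this ⊢; linarith [norm_sub_norm_le w 1, norm_sub_rev w 1]) h1
    refine (tendsto_inv_atTop_zero.comp h2).congr fun w => ?_
    simp [norm_inv]
  · exact (eventually_inf_principal.2 (Eventually.of_forall fun w hw => inv_one_sub_mem hw))

/-- **Boundary values on the negative half-line.** For `v < 0`, with `u = (1 - v)⁻¹ ∈ (0, 1)`:
`S(w) → ζ (B(1/3,1/3) - B(u; 1/3,1/3))` as `w → v` within `ℍₒ` — a point of the open side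
`(0, ζ B(1/3,1/3))`. [folklore] -/
theorem tendsto_scFun_of_neg {v : ℝ} (hv : v < 0) :
    Tendsto scFun (𝓝[upperHalfPlaneSet] v)
      (𝓝 (equilateralApex * (incBeta13 1 - incBeta13 ((1 - v)⁻¹)))) := by
  have hu : (1 - v)⁻¹ ∈ Icc (0 : ℝ) 1 :=
    ⟨inv_nonneg.2 (by linarith), inv_le_one_of_one_le₀ (by linarith)⟩
  have h1 := tendsto_inv_one_sub_nhdsWithin (v := (v : ℂ)) (by exact_mod_cast hv.ne.symm ∘ fun h => by linarith [h])
  have hcast : ((1 : ℂ) - v)⁻¹ = (((1 - v)⁻¹ : ℝ) : ℂ) := by push_cast; ring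
  rw [hcast] at h1
  have h2 := (tendsto_scFun_of_mem_Icc hu).comp h1
  have h3 : Tendsto (fun w => equilateralApex * (incBeta13 1 - scFun ((1 - w)⁻¹)))
      (𝓝[upperHalfPlaneSet] v) (𝓝 (equilateralApex * (incBeta13 1 - incBeta13 ((1 - v)⁻¹)))) :=
    (tendsto_const_nhds.sub h2).const_mul _
  exact h3.congr' (eventually_mem_nhdsWithin.mono fun w hw => (scFun_eq_of_inv_one_sub hw).symm)

/-- `ζ² = ζ - 1` for the primitive sixth root of unity `ζ = e^{iπ/3}`. [folklore] -/
theorem equilateralApex_sq : equilateralApex ^ 2 = equilateralApex - 1 := by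
  refine Complex.ext ?_ ?_
  · simp [sq]
    have := Real.mul_self_sqrt (show (0 : ℝ) ≤ 3 by norm_num)
    nlinarith [this]
  · simp [sq]; ring

/-- **Boundary values on `(1, ∞)`.** For `v > 1`, with `u = 1 - v⁻¹ ∈ (0, 1)`:
`S(w) → (B(1/3,1/3) - B(u;1/3,1/3)) + ζ B(u;1/3,1/3)` as `w → v` within `ℍₒ` — a point of the open
side `(B(1/3,1/3), ζ B(1/3,1/3))`. [folklore] -/
theorem tendsto_scFun_of_one_lt {v : ℝ} (hv : 1 < v) :
    Tendsto scFun (𝓝[upperHalfPlaneSet] v)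
      (𝓝 (((incBeta13 1 - incBeta13 (1 - v⁻¹) : ℝ) : ℂ) + equilateralApex * incBeta13 (1 - v⁻¹))) := by
  have hv' : (1 - v)⁻¹ < 0 := inv_lt_zero.2 (by linarith)
  have h1 := tendsto_inv_one_sub_nhdsWithin (v := (v : ℂ))
    (by intro h; have := congrArg Complex.re h; simp at this; linarith)
  have hcast : ((1 : ℂ) - v)⁻¹ = (((1 - v)⁻¹ : ℝ) : ℂ) := by push_cast; ring
  rw [hcast] at h1
  have h2 := (tendsto_scFun_of_neg hv').comp h1
  have hu : (1 - (1 - v)⁻¹)⁻¹ = 1 - v⁻¹ := by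
    have h0 : v ≠ 0 := by positivity
    have h1' : 1 - v ≠ 0 := by linarith
    have e1 : 1 - (1 - v)⁻¹ = -v / (1 - v) := by field_simp; ring
    rw [e1, inv_div]
    field_simp
    ring
  rw [hu] at h2
  have h3 := (tendsto_const_nhds (x := (incBeta13 1 : ℂ))).sub h2
  have h4 := h3.const_mul equilateralApex
  refine (h4.congr' (eventually_mem_nhdsWithin.mono fun w hw =>
    (scFun_eq_of_inv_one_sub hw).symm)).trans ?_
  apply le_of_eq
  congr 1
  push_cast
  linear_combination (incBeta13 (1 - v⁻¹) - incBeta13 1 : ℂ) * equilateralApex_sq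

/-- **Boundary value at `∞`.** `S(w) → ζ B(1/3, 1/3)` (the apex of the triangle) as `w → ∞` within
`ℍₒ`. [folklore] -/
theorem tendsto_scFun_atInfty :
    Tendsto scFun (cocompact ℂ ⊓ 𝓟 upperHalfPlaneSet) (𝓝 (equilateralApex * incBeta13 1)) := by
  have h2 := tendsto_scFun_zero_upperHalfPlaneSet.comp tendsto_inv_one_sub_atInfty
  have h3 := ((tendsto_const_nhds (x := (incBeta13 1 : ℂ))).sub h2).const_mul equilateralApex
  rw [sub_zero] at h3
  refine h3.congr' ?_
  exact eventually_inf_principal.2 (Eventually.of_forall fun w hw => (scFun_eq_of_inv_one_sub hw).symm)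

/-! ### The normalised map `Ψ = S / B(1/3, 1/3)` -/

/-- The normalised Schwarz–Christoffel map `Ψ(w) = S(w) / B(1/3, 1/3)` of the equilateral triangle
with vertices `Ψ(0) = 0`, `Ψ(1) = 1`, `Ψ(∞) = ζ` (Berenstein–Gay 1991, §2.8 Example (2)). [cite: BerensteinGay1991, §2.8 Example (2)] -/
def scPsi (w : ℂ) : ℂ := scFun w / incBeta13 1

/-- `B(1/3, 1/3) ≠ 0` in `ℂ`. [folklore] -/
theorem incBeta13_one_ne_zero_complex : (incBeta13 1 : ℂ) ≠ 0 :=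
  ofReal_ne_zero.2 incBeta13_one_pos.ne'

/-- `Ψ` is holomorphic on `ℍₒ`. [folklore] -/
theorem differentiableOn_scPsi : DifferentiableOn ℂ scPsi upperHalfPlaneSet :=
  differentiableOn_scFun_upperHalfPlaneSet.div_const _

/-- `Ψ' = S' / B(1/3, 1/3)` on `ℍₒ`. [folklore] -/
theorem hasDerivAt_scPsi {w : ℂ} (hw : w ∈ upperHalfPlaneSet) :
    HasDerivAt scPsi (scDeriv w / incBeta13 1) w :=
  (hasDerivAt_scFun_of_mem hw).div_const _

/-- `Ψ' ≠ 0` on `ℍₒ`. [folklore] -/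
theorem deriv_scPsi_ne_zero {w : ℂ} (hw : w ∈ upperHalfPlaneSet) : deriv scPsi w ≠ 0 := by
  rw [(hasDerivAt_scPsi hw).deriv]
  exact div_ne_zero (scDeriv_ne_zero (upperHalfPlaneSet_subset_scDomain hw) (Or.inr (ne_of_gt hw)))
    incBeta13_one_ne_zero_complex

/-- `Ψ` is injective on `ℍₒ`. [folklore] -/
theorem scPsi_injOn : InjOn scPsi upperHalfPlaneSet := fun _ ha _ hb h =>
  scFun_injOn ha hb ((div_left_inj' incBeta13_one_ne_zero_complex).1 h)

/-- `Im Ψ > 0` on `ℍₒ`. [folklore] -/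
theorem scPsi_im_pos {w : ℂ} (hw : 0 < w.im) : 0 < (scPsi w).im := by
  rw [scPsi, div_ofReal_im]
  exact div_pos (scFun_im_pos hw) incBeta13_one_pos

/-- The image `Ψ(ℍₒ)` lies in `ℍₒ`. [folklore] -/
theorem scPsi_image_subset_upperHalfPlaneSet : scPsi '' upperHalfPlaneSet ⊆ upperHalfPlaneSet := by
  rintro _ ⟨w, hw, rfl⟩
  exact scPsi_im_pos hw

/-- The image `Ψ(ℍₒ)` is open (inverse function theorem). [folklore] -/
theorem isOpen_scPsi_image : IsOpen (scPsi '' upperHalfPlaneSet) :=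
  Complex.isOpen_image_of_deriv_ne_zero isOpen_upperHalfPlaneSet differentiableOn_scPsi
    fun _ hz => deriv_scPsi_ne_zero hz

/-! ### Boundary values of `Ψ` -/

/-- The normalised incomplete beta ratio `s(t) = B(t; 1/3,1/3) / B(1/3,1/3)`. [folklore] -/
def scRatio (t : ℝ) : ℝ := incBeta13 t / incBeta13 1

/-- `s(t) ∈ [0, 1]` for `t ∈ [0, 1]`. [folklore] -/
theorem scRatio_mem_Icc {t : ℝ} (ht : t ∈ Icc (0 : ℝ) 1) : scRatio t ∈ Icc (0 : ℝ) 1 := by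
  refine ⟨div_nonneg (incBeta13_nonneg ht) incBeta13_one_pos.le, ?_⟩
  rw [scRatio, div_le_one incBeta13_one_pos]
  exact strictMonoOn_incBeta13.monotoneOn ht ⟨zero_le_one, le_rfl⟩ ht.2

/-- `s(t) ∈ (0, 1)` for `t ∈ (0, 1)`. [folklore] -/
theorem scRatio_mem_Ioo {t : ℝ} (ht : t ∈ Ioo (0 : ℝ) 1) : scRatio t ∈ Ioo (0 : ℝ) 1 := by
  refine ⟨div_pos (incBeta13_pos ⟨ht.1, ht.2.le⟩) incBeta13_one_pos, ?_⟩
  rw [scRatio, div_lt_one incBeta13_one_pos]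
  exact strictMonoOn_incBeta13 ⟨ht.1.le, ht.2.le⟩ ⟨zero_le_one, le_rfl⟩ ht.2

/-- Boundary values on `[0, 1]`: `Ψ(w) → s(u)` as `w → u ∈ [0, 1]` within `ℍₒ`. [folklore] -/
theorem tendsto_scPsi_of_mem_Icc {u : ℝ} (hu : u ∈ Icc (0 : ℝ) 1) :
    Tendsto scPsi (𝓝[upperHalfPlaneSet] u) (𝓝 ((scRatio u : ℝ) : ℂ)) := by
  have h := (tendsto_scFun_of_mem_Icc hu).div_const (incBeta13 1 : ℂ)
  rw [scRatio]
  push_cast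
  exact h

/-- Boundary values on `(-∞, 0)`: `Ψ(w) → (1 - s(t)) ζ`, `t = (1 - v)⁻¹ ∈ (0, 1)`, as `w → v < 0`
within `ℍₒ`. [folklore] -/
theorem tendsto_scPsi_of_neg {v : ℝ} (hv : v < 0) :
    Tendsto scPsi (𝓝[upperHalfPlaneSet] v)
      (𝓝 (((1 - scRatio ((1 - v)⁻¹) : ℝ) : ℂ) * equilateralApex)) := by
  have h := (tendsto_scFun_of_neg hv).div_const (incBeta13 1 : ℂ)
  have hB := incBeta13_one_ne_zero_complex
  have key : equilateralApex * ((incBeta13 1 : ℂ) - incBeta13 ((1 - v)⁻¹)) / incBeta13 1 =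
      (((1 - scRatio ((1 - v)⁻¹)) : ℝ) : ℂ) * equilateralApex := by
    rw [scRatio]; push_cast; rw [mul_div_assoc, sub_div, div_self hB]; ring
  rw [← key]
  exact h

/-- Boundary values on `(1, ∞)`: `Ψ(w) → (1 - s(t)) + s(t) ζ`, `t = 1 - v⁻¹ ∈ (0, 1)`, as
`w → v > 1` within `ℍₒ`. [folklore] -/
theorem tendsto_scPsi_of_one_lt {v : ℝ} (hv : 1 < v) :
    Tendsto scPsi (𝓝[upperHalfPlaneSet] v)
      (𝓝 (((1 - scRatio (1 - v⁻¹) : ℝ) : ℂ) + (scRatio (1 - v⁻¹) : ℂ) * equilateralApex)) := by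
  have h := (tendsto_scFun_of_one_lt hv).div_const (incBeta13 1 : ℂ)
  have hB := incBeta13_one_ne_zero_complex
  have key : (((incBeta13 1 - incBeta13 (1 - v⁻¹) : ℝ) : ℂ) + equilateralApex * incBeta13 (1 - v⁻¹)) /
      incBeta13 1 = ((1 - scRatio (1 - v⁻¹) : ℝ) : ℂ) + (scRatio (1 - v⁻¹) : ℂ) * equilateralApex := by
    rw [scRatio]; push_cast; rw [add_div, sub_div, div_self hB]; ring
  rw [← key]
  exact h

/-- Boundary value at `∞`: `Ψ(w) → ζ` as `w → ∞` within `ℍₒ`. [folklore] -/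
theorem tendsto_scPsi_atInfty :
    Tendsto scPsi (cocompact ℂ ⊓ 𝓟 upperHalfPlaneSet) (𝓝 equilateralApex) := by
  have h := tendsto_scFun_atInfty.div_const (incBeta13 1 : ℂ)
  rw [mul_div_assoc, div_self incBeta13_one_ne_zero_complex, mul_one] at h
  exact h

/-- `Ψ` has a limit within `ℍₒ` at every real point. [folklore] -/
theorem exists_tendsto_scPsi_real (u : ℝ) : ∃ y, Tendsto scPsi (𝓝[upperHalfPlaneSet] u) (𝓝 y) := by
  rcases lt_or_ge u 0 with hu | hu
  · exact ⟨_, tendsto_scPsi_of_neg hu⟩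
  rcases le_or_gt u 1 with hu1 | hu1
  · exact ⟨_, tendsto_scPsi_of_mem_Icc ⟨hu, hu1⟩⟩
  · exact ⟨_, tendsto_scPsi_of_one_lt hu1⟩

/-- `Ψ` has a limit within `ℍₒ` at every point of the closed upper half-plane. [folklore] -/
theorem exists_tendsto_scPsi_of_im_nonneg {x : ℂ} (hx : 0 ≤ x.im) :
    ∃ y, Tendsto scPsi (𝓝[upperHalfPlaneSet] x) (𝓝 y) := by
  rcases hx.lt_or_eq with hx | hx
  · exact ⟨scPsi x, differentiableOn_scPsi.continuousOn x hx⟩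
  · have : ((x.re : ℝ) : ℂ) = x := Complex.ext (by simp) (by simp [← hx])
    rw [← this]
    exact exists_tendsto_scPsi_real x.re

/-! ### The continuous extension to the closed half-plane -/

/-- The extension of `Ψ` to `{im ≥ 0}` by boundary values. [folklore] -/
def scPsiExt : ℂ → ℂ := extendFrom upperHalfPlaneSet scPsi

/-- The extension is continuous on the closed half-plane `{im ≥ 0} = closure ℍₒ`
(`Literature.Probability.RandomPlanarGeometry.mem_closure_upperHalfPlaneSet_iff`). [folklore] -/
theorem continuousOn_scPsiExt : ContinuousOn scPsiExt {z : ℂ | 0 ≤ z.im} :=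
  continuousOn_extendFrom (fun _ hz => mem_closure_upperHalfPlaneSet_iff.2 hz)
    fun _ hx => exists_tendsto_scPsi_of_im_nonneg hx

/-- The extension agrees with `Ψ` on `ℍₒ`. [folklore] -/
theorem scPsiExt_eq {w : ℂ} (hw : w ∈ upperHalfPlaneSet) : scPsiExt w = scPsi w :=
  extendFrom_extends differentiableOn_scPsi.continuousOn w hw

/-- At a real point the extension is the boundary value. [folklore] -/
theorem tendsto_scPsi_scPsiExt {w : ℂ} (hw : w.im = 0) :
    Tendsto scPsi (𝓝[upperHalfPlaneSet] w) (𝓝 (scPsiExt w)) := by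
  obtain ⟨y, hy⟩ := exists_tendsto_scPsi_of_im_nonneg hw.symm.le
  rwa [scPsiExt, extendFrom_eq (mem_closure_upperHalfPlaneSet_iff.2 hw.symm.le) hy]

/-- **Cluster values are boundary values.** A point of `closure Ψ(ℍₒ)` is in `Ψ(ℍₒ)`, or is the
value `ζ` at `∞`, or is the boundary value of `Ψ` at a real point (compactness of closed bounded
sets in `{im ≥ 0}` and continuity of the extension). [folklore] -/
theorem mem_image_or_of_mem_closure {p : ℂ} (hp : p ∈ closure (scPsi '' upperHalfPlaneSet)) :
    p ∈ scPsi '' upperHalfPlaneSet ∨ p = equilateralApex ∨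
      ∃ u : ℝ, Tendsto scPsi (𝓝[upperHalfPlaneSet] u) (𝓝 p) := by
  by_cases hpζ : p = equilateralApex
  · exact Or.inr (Or.inl hpζ)
  obtain ⟨Vp, Vζ, hVp, hVζ, hpV, hζV, hdisj⟩ := t2_separation hpζ
  have h1 : scPsi ⁻¹' Vζ ∈ cocompact ℂ ⊓ 𝓟 upperHalfPlaneSet :=
    tendsto_scPsi_atInfty (hVζ.mem_nhds hζV)
  rw [mem_inf_principal, Filter.mem_cocompact] at h1
  obtain ⟨K, hK, hKsub⟩ := h1
  set C : Set ℂ := K ∩ {z : ℂ | 0 ≤ z.im} with hCdef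
  have hC : IsCompact C := hK.inter_right (isClosed_le continuous_const continuous_im)
  have hCimg : IsClosed (scPsiExt '' C) :=
    (hC.image_of_continuousOn (continuousOn_scPsiExt.mono inter_subset_right)).isClosed
  have h2 : scPsi '' upperHalfPlaneSet ∩ Vp ⊆ scPsiExt '' C := by
    rintro _ ⟨⟨w, hw, rfl⟩, hV⟩
    have hwK : w ∈ K := by
      by_contra hwK
      exact disjoint_left.1 hdisj hV (hKsub hwK hw)
    exact ⟨w, ⟨hwK, show (0 : ℝ) ≤ w.im from le_of_lt hw⟩, scPsiExt_eq hw⟩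
  have h3 : p ∈ closure (scPsi '' upperHalfPlaneSet ∩ Vp) := hVp.closure_inter ⟨hp, hpV⟩
  have h4 : p ∈ scPsiExt '' C := by
    rw [← hCimg.closure_eq]
    exact closure_mono h2 h3
  obtain ⟨w, ⟨-, hwim⟩, hwp⟩ := h4
  have hwim' : (0 : ℝ) ≤ w.im := hwim
  rcases hwim'.lt_or_eq with hw | hw
  · left
    rw [← hwp, scPsiExt_eq hw]
    exact ⟨w, hw, rfl⟩
  · right; right
    refine ⟨w.re, ?_⟩
    have hwre : ((w.re : ℝ) : ℂ) = w := Complex.ext (by simp) (by simp [← hw])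
    rw [hwre, ← hwp]
    exact tendsto_scPsi_scPsiExt hw.symm

/-! ### Half-planes -/

/-- The open half-plane `{z | c < a re z + b im z}`. [folklore] -/
def openHalfPlane (a b c : ℝ) : Set ℂ := {z : ℂ | c < a * z.re + b * z.im}

/-- `z ↦ a re z + b im z` is `ℝ`-linear. [folklore] -/
theorem isLinearMap_re_im (a b : ℝ) : IsLinearMap ℝ fun z : ℂ => a * z.re + b * z.im :=
  ⟨fun x y => by simp only [add_re, add_im]; ring, fun c x => by simp only [real_smul, mul_re,
    ofReal_re, ofReal_im, zero_mul, sub_zero, mul_im, add_zero, smul_eq_mul]; ring⟩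

/-- Open half-planes are preconnected (convex). [folklore] -/
theorem isPreconnected_openHalfPlane (a b c : ℝ) : IsPreconnected (openHalfPlane a b c) :=
  (convex_halfSpace_gt (isLinearMap_re_im a b) c).isPreconnected

/-- The complement of an open half-plane (a closed half-plane) is convex. [folklore] -/
theorem convex_compl_openHalfPlane (a b c : ℝ) : Convex ℝ (openHalfPlane a b c)ᶜ := by
  have : (openHalfPlane a b c)ᶜ = {z : ℂ | a * z.re + b * z.im ≤ c} := by
    ext z; simp [openHalfPlane, not_lt]
  rw [this]
  exact convex_halfSpace_le (isLinearMap_re_im a b) c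

/-- A point of the boundary line `a re z + b im z = c` is in the closure of the open half-plane
`{c < a re z + b im z}` (`(a, b) ≠ 0`): move in the direction `(a, b)`. [folklore] -/
theorem mem_closure_openHalfPlane {a b c : ℝ} (hab : 0 < a ^ 2 + b ^ 2) {p : ℂ}
    (hp : a * p.re + b * p.im = c) : p ∈ closure (openHalfPlane a b c) := by
  have hγ : Tendsto (fun t : ℝ => p + (t : ℂ) * ⟨a, b⟩) (𝓝[>] 0) (𝓝 p) := by
    have : Continuous fun t : ℝ => p + (t : ℂ) * ⟨a, b⟩ := by fun_prop
    simpa using (this.tendsto 0).mono_left nhdsWithin_le_nhds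
  refine mem_closure_of_tendsto hγ (eventually_mem_nhdsWithin.mono fun t (ht : 0 < t) => ?_)
  show c < a * (p + (t : ℂ) * ⟨a, b⟩).re + b * (p + (t : ℂ) * ⟨a, b⟩).im
  simp only [add_re, mul_re, ofReal_re, ofReal_im, zero_mul, sub_zero, add_im, mul_im, add_zero]
  nlinarith [mul_pos ht hab]

/-- The three open outer half-planes of the reference triangle `(1, ζ, 0)`: below the side `[0, 1]`,
beyond the side `[1, ζ]` (the line `√3 re + im = √3`), beyond the side `[ζ, 0]` (the line
`im = √3 re`). [folklore] -/
def scOuter : Fin 3 → Set ℂ :=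
  ![openHalfPlane 0 (-1) 0, openHalfPlane (Real.sqrt 3) 1 (Real.sqrt 3), openHalfPlane (-Real.sqrt 3) 1 0]

/-- `1 < √3`. [folklore] -/
theorem one_lt_sqrt_three : (1 : ℝ) < Real.sqrt 3 := by
  rw [show (1 : ℝ) = Real.sqrt 1 by simp]
  exact Real.sqrt_lt_sqrt zero_le_one (by norm_num)

/-- Each outer half-plane is preconnected. [folklore] -/
theorem isPreconnected_scOuter (i : Fin 3) : IsPreconnected (scOuter i) := by
  fin_cases i <;> exact isPreconnected_openHalfPlane _ _ _

/-- Each outer half-plane contains a point of the open lower half-plane. [folklore] -/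
theorem exists_mem_scOuter_im_neg (i : Fin 3) : ∃ q ∈ scOuter i, q.im < 0 := by
  have h3 := one_lt_sqrt_three
  fin_cases i
  · exact ⟨-I, by simp [scOuter, openHalfPlane], by simp⟩
  · exact ⟨2 - I, by simp [scOuter, openHalfPlane]; linarith, by simp⟩
  · exact ⟨-1 - I, by simp [scOuter, openHalfPlane]; linarith, by simp⟩

/-- The three vertices `1, ζ, 0` lie in the closed inner half-planes. [folklore] -/
theorem vertices_subset_compl_scOuter (i : Fin 3) :
    ({(1 : ℂ), equilateralApex, 0} : Set ℂ) ⊆ (scOuter i)ᶜ := by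
  have h3 := one_lt_sqrt_three
  intro z hz
  simp only [mem_insert_iff, mem_singleton_iff] at hz
  fin_cases i <;> rcases hz with rfl | rfl | rfl <;>
    simp [scOuter, openHalfPlane] <;> nlinarith [Real.sqrt_nonneg 3]

/-- The open reference triangle misses the closure of each outer half-plane. [folklore] -/
theorem refEquilateralTriangle_subset_compl_closure (i : Fin 3) :
    refEquilateralTriangle ⊆ (closure (scOuter i))ᶜ := by
  rw [← interior_compl]
  exact interior_mono (convexHull_min (vertices_subset_compl_scOuter i) (by
    fin_cases i <;> exact convex_compl_openHalfPlane _ _ _))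

/-! ### The admissible boundary values -/

/-- The set of admissible boundary values: points of the closed triangle (in no outer half-plane)
lying on one of the three side lines (in the closure of some outer half-plane). [folklore] -/
def scGood : Set ℂ := {p : ℂ | (∀ i, p ∉ scOuter i) ∧ ∃ i, p ∈ closure (scOuter i)}

/-- The boundary value `s ∈ [0, 1]` (on the side `[0, 1]`) is admissible. [folklore] -/
theorem ofReal_mem_scGood {s : ℝ} (hs : s ∈ Icc (0 : ℝ) 1) : ((s : ℝ) : ℂ) ∈ scGood := by
  have h3 := one_lt_sqrt_three
  refine ⟨fun i => ?_, ⟨0, ?_⟩⟩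
  · fin_cases i <;> simp [scOuter, openHalfPlane] <;> nlinarith [hs.1, hs.2]
  · exact mem_closure_openHalfPlane (by norm_num) (by simp)

/-- The boundary value `a ζ`, `a ∈ [0, 1]` (on the side `[ζ, 0]`) is admissible. [folklore] -/
theorem mul_apex_mem_scGood {a : ℝ} (ha : a ∈ Icc (0 : ℝ) 1) : (a : ℂ) * equilateralApex ∈ scGood := by
  have h3 := one_lt_sqrt_three
  refine ⟨fun i => ?_, ⟨2, ?_⟩⟩
  · fin_cases i <;> simp [scOuter, openHalfPlane] <;> nlinarith [ha.1, ha.2, Real.sqrt_nonneg 3]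
  · refine mem_closure_openHalfPlane (by positivity) ?_
    simp; ring

/-- The boundary value `(1 - a) + a ζ`, `a ∈ [0, 1]` (on the side `[1, ζ]`) is admissible. [folklore] -/
theorem side_point_mem_scGood {a : ℝ} (ha : a ∈ Icc (0 : ℝ) 1) :
    ((1 - a : ℝ) : ℂ) + (a : ℂ) * equilateralApex ∈ scGood := by
  have h3 := one_lt_sqrt_three
  refine ⟨fun i => ?_, ⟨1, ?_⟩⟩
  · fin_cases i <;> simp [scOuter, openHalfPlane] <;> nlinarith [ha.1, ha.2, Real.sqrt_nonneg 3]
  · refine mem_closure_openHalfPlane (by positivity) ?_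
    simp; ring

/-- The apex `ζ` is admissible. [folklore] -/
theorem apex_mem_scGood : equilateralApex ∈ scGood := by
  simpa using side_point_mem_scGood (a := 1) ⟨zero_le_one, le_rfl⟩

/-- Every boundary value of `Ψ` at a real point is admissible. [folklore] -/
theorem mem_scGood_of_tendsto {u : ℝ} {p : ℂ} (h : Tendsto scPsi (𝓝[upperHalfPlaneSet] u) (𝓝 p)) :
    p ∈ scGood := by
  haveI := neBot_nhdsWithin_upperHalfPlaneSet u
  rcases lt_or_ge u 0 with hu | hu
  · rw [tendsto_nhds_unique h (tendsto_scPsi_of_neg hu)]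
    have ht : (1 - u)⁻¹ ∈ Ioo (0 : ℝ) 1 := ⟨inv_pos.2 (by linarith), inv_lt_one_of_one_lt₀ (by linarith)⟩
    have hs := scRatio_mem_Ioo ht
    exact mul_apex_mem_scGood ⟨by linarith [hs.2], by linarith [hs.1]⟩
  rcases le_or_gt u 1 with hu1 | hu1
  · rw [tendsto_nhds_unique h (tendsto_scPsi_of_mem_Icc ⟨hu, hu1⟩)]
    exact ofReal_mem_scGood (scRatio_mem_Icc ⟨hu, hu1⟩)
  · rw [tendsto_nhds_unique h (tendsto_scPsi_of_one_lt hu1)]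
    have hu0 : 0 < u := by linarith
    have ht : 1 - u⁻¹ ∈ Ioo (0 : ℝ) 1 :=
      ⟨by rw [sub_pos]; exact inv_lt_one_of_one_lt₀ hu1, by simp [inv_pos.2 hu0]⟩
    have hs := scRatio_mem_Ioo ht
    exact side_point_mem_scGood ⟨hs.1.le, hs.2.le⟩

/-- **`closure Ψ(ℍₒ) ⊆ Ψ(ℍₒ) ∪ scGood`.** [folklore] -/
theorem closure_scPsi_image_subset :
    closure (scPsi '' upperHalfPlaneSet) ⊆ scPsi '' upperHalfPlaneSet ∪ scGood := by
  intro p hp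
  rcases mem_image_or_of_mem_closure hp with h | rfl | ⟨u, hu⟩
  · exact Or.inl h
  · exact Or.inr apex_mem_scGood
  · exact Or.inr (mem_scGood_of_tendsto hu)

/-! ### The image is the open triangle -/

/-- The image misses each outer half-plane: `Hᵢ` is connected, misses `closure Ψ(ℍₒ) ∖ Ψ(ℍₒ)`, and
is not contained in `Ψ(ℍₒ) ⊆ ℍₒ`. [folklore] -/
theorem scPsi_image_inter_scOuter (i : Fin 3) : scPsi '' upperHalfPlaneSet ∩ scOuter i = ∅ := by
  by_contra hne
  have hne' : (scOuter i ∩ scPsi '' upperHalfPlaneSet).Nonempty := by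
    rw [inter_comm]; exact nonempty_iff_ne_empty.2 hne
  have hsub : scOuter i ⊆ scPsi '' upperHalfPlaneSet := by
    refine (isPreconnected_scOuter i).subset_of_closure_inter_subset isOpen_scPsi_image hne' ?_
    rintro p ⟨hpc, hpi⟩
    rcases closure_scPsi_image_subset hpc with h | h
    · exact h
    · exact absurd hpi (h.1 i)
  obtain ⟨q, hq, hqim⟩ := exists_mem_scOuter_im_neg i
  have := scPsi_image_subset_upperHalfPlaneSet (hsub hq)
  exact absurd this (not_lt.2 hqim.le)

/-- Points of the image lie in no outer half-plane. [folklore] -/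
theorem not_mem_scOuter_of_mem_image {q : ℂ} (hq : q ∈ scPsi '' upperHalfPlaneSet) (i : Fin 3) :
    q ∉ scOuter i := fun h =>
  (eq_empty_iff_forall_notMem.1 (scPsi_image_inter_scOuter i)) q ⟨hq, h⟩

/-- Points of the image lie strictly inside each side line. [folklore] -/
theorem not_mem_closure_scOuter_of_mem_image {q : ℂ} (hq : q ∈ scPsi '' upperHalfPlaneSet)
    (i : Fin 3) : q ∉ closure (scOuter i) := by
  intro hcl
  rw [mem_closure_iff_nhds] at hcl
  obtain ⟨z, hzO, hzi⟩ := hcl _ (isOpen_scPsi_image.mem_nhds hq)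
  have : z ∈ scPsi '' upperHalfPlaneSet ∩ scOuter i := ⟨hzO, hzi⟩
  rw [scPsi_image_inter_scOuter i] at this
  exact this

/-- A point strictly inside the three side lines is in the convex hull of the vertices (explicit
barycentric coordinates). [folklore] -/
theorem mem_convexHull_of_strict {z : ℂ} (h1 : 0 < z.im) (h2 : Real.sqrt 3 * z.re + z.im < Real.sqrt 3)
    (h3 : 0 < Real.sqrt 3 * z.re - z.im) :
    z ∈ convexHull ℝ ({(1 : ℂ), equilateralApex, 0} : Set ℂ) := by
  set r := Real.sqrt 3 with hr
  have hr2 : r * r = 3 := Real.mul_self_sqrt (by norm_num)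
  have hr0 : 0 < r := by rw [hr]; positivity
  -- weights of `1`, `ζ`, `0`
  set a : ℝ := z.re - r * z.im / 3 with ha
  set b : ℝ := 2 * r * z.im / 3 with hb
  set c : ℝ := 1 - z.re - r * z.im / 3 with hc
  have ha0 : 0 ≤ a := by rw [ha]; nlinarith
  have hb0 : 0 ≤ b := by rw [hb]; positivity
  have hc0 : 0 ≤ c := by rw [hc]; nlinarith
  have hsum : a + b + c = 1 := by rw [ha, hb, hc]; ring
  have hz : z = a • (1 : ℂ) + b • equilateralApex + c • (0 : ℂ) := by
    refine Complex.ext ?_ ?_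
    · simp [ha, hb]; ring
    · simp [hb]; nlinarith
  have hconv := convex_convexHull ℝ ({(1 : ℂ), equilateralApex, 0} : Set ℂ)
  have h1m : (1 : ℂ) ∈ convexHull ℝ ({(1 : ℂ), equilateralApex, 0} : Set ℂ) :=
    subset_convexHull ℝ _ (by simp)
  have hζm : equilateralApex ∈ convexHull ℝ ({(1 : ℂ), equilateralApex, 0} : Set ℂ) :=
    subset_convexHull ℝ _ (by simp)
  have h0m : (0 : ℂ) ∈ convexHull ℝ ({(1 : ℂ), equilateralApex, 0} : Set ℂ) :=
    subset_convexHull ℝ _ (by simp)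
  have key := hconv.sum_mem (t := Finset.univ) (w := ![a, b, c]) (z := ![(1 : ℂ), equilateralApex, 0])
    (by intro i _; fin_cases i <;> simpa) (by simp [Fin.sum_univ_three, hsum])
    (by intro i _; fin_cases i <;> simpa)
  simpa [Fin.sum_univ_three, hz] using key

/-- **`Ψ(ℍₒ) ⊆ T₀`.** [folklore] -/
theorem scPsi_image_subset : scPsi '' upperHalfPlaneSet ⊆ refEquilateralTriangle := by
  refine interior_maximal (fun q hq => ?_) isOpen_scPsi_image
  have hn := not_mem_closure_scOuter_of_mem_image hq
  have h1 : 0 < q.im := scPsi_image_subset_upperHalfPlaneSet hq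
  have hn' := not_mem_scOuter_of_mem_image hq
  have h2 : Real.sqrt 3 * q.re + q.im < Real.sqrt 3 := by
    by_contra h
    rcases (not_lt.1 h).eq_or_lt with h | h
    · exact hn 1 (mem_closure_openHalfPlane (by positivity) (by simpa using h.symm))
    · exact hn' 1 (by simpa [scOuter, openHalfPlane] using h)
  have h3 : 0 < Real.sqrt 3 * q.re - q.im := by
    by_contra h
    rcases (not_lt.1 h).eq_or_lt with h | h
    · exact hn 2 (mem_closure_openHalfPlane (by positivity) (by simp; linarith))
    · exact hn' 2 (by simp [scOuter, openHalfPlane]; linarith)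
  exact mem_convexHull_of_strict h1 h2 h3

/-- **`T₀ ⊆ Ψ(ℍₒ)`**: `T₀` is connected, meets the image, and misses
`closure Ψ(ℍₒ) ∖ Ψ(ℍₒ)`. [folklore] -/
theorem subset_scPsi_image : refEquilateralTriangle ⊆ scPsi '' upperHalfPlaneSet := by
  have hne : (refEquilateralTriangle ∩ scPsi '' upperHalfPlaneSet).Nonempty := by
    have hI : I ∈ upperHalfPlaneSet := by simp [upperHalfPlaneSet]
    exact ⟨scPsi I, scPsi_image_subset ⟨I, hI, rfl⟩, ⟨I, hI, rfl⟩⟩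
  refine (convex_convexHull ℝ _).interior.isPreconnected.subset_of_closure_inter_subset
    isOpen_scPsi_image hne ?_
  rintro p ⟨hpc, hpT⟩
  rcases closure_scPsi_image_subset hpc with h | ⟨-, i, hi⟩
  · exact h
  · exact absurd hi (refEquilateralTriangle_subset_compl_closure i hpT)

/-- **The image of `ℍₒ` under `Ψ` is the open reference triangle.** [cite: BerensteinGay1991, §2.8 Example (2)] -/
theorem scPsi_image_eq : scPsi '' upperHalfPlaneSet = refEquilateralTriangle :=
  Subset.antisymm scPsi_image_subset subset_scPsi_image

/-! ### The conformal equivalence and the named fact -/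

/-- `Ψ` is a bijection of `ℍₒ` onto the open reference triangle. [cite: BerensteinGay1991, §2.8 Example (2)] -/
theorem scPsi_bijOn : BijOn scPsi upperHalfPlaneSet refEquilateralTriangle :=
  ⟨mapsTo_iff_image_subset.2 scPsi_image_subset, scPsi_injOn, subset_scPsi_image⟩

/-- The inverse of `Ψ` is holomorphic on the open triangle (inverse function theorem,
`Complex.differentiableOn_invFunOn_image`). [folklore] -/
theorem differentiableOn_invFunOn_scPsi :
    DifferentiableOn ℂ (Function.invFunOn scPsi upperHalfPlaneSet) refEquilateralTriangle := by
  rw [← scPsi_image_eq]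
  exact Complex.differentiableOn_invFunOn_image isOpen_upperHalfPlaneSet differentiableOn_scPsi
    scPsi_injOn fun _ hz => deriv_scPsi_ne_zero hz

/-- **The Schwarz–Christoffel uniformizing map of the equilateral triangle** as a conformal
equivalence `ℍₒ → T₀` (Berenstein–Gay 1991, §2.8, Prop. 2.8.14 and Example (2)). [cite: BerensteinGay1991, §2.8 Prop. 2.8.14 and Example (2)] -/
def scUniformizer : ConformalEquiv upperHalfPlaneSet refEquilateralTriangle :=
  ConformalEquiv.ofBijOn scPsi differentiableOn_scPsi scPsi_bijOn differentiableOn_invFunOn_scPsi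

/-- `scUniformizer` acts as `Ψ`. [folklore] -/
@[simp] theorem scUniformizer_apply (z : ℂ) : scUniformizer z = scPsi z := rfl

/-- **Schwarz–Christoffel uniformization of the equilateral triangle**
(`Literature.Probability.RandomPlanarGeometry.schwarzTriangleMap_isUniformizing` holds): `Ψ = S / B(1/3,1/3)` is a conformal equivalence of
`ℍₒ` onto the open triangle `(1, ζ, 0)` with boundary values `B(u;1/3,1/3)/B(1/3,1/3)` at
`u ∈ [0, 1]`, points of the open side `(ζ, 0)` at `u < 0`, points of the open side `(1, ζ)` at
`u > 1`, and `ζ` at `∞` (Berenstein–Gay 1991, §2.8, Prop. 2.8.14 and Example (2)). [cite: BerensteinGay1991, §2.8 Prop. 2.8.14 and Example (2)] -/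
theorem schwarzTriangleMap_isUniformizing_holds : schwarzTriangleMap_isUniformizing := by
  refine ⟨scUniformizer, fun w hw => ?_, fun u hu => ?_, fun u hu => ?_, fun u hu => ?_, ?_⟩
  · show scPsi w = schwarzTriangleMap w / incBeta13 1
    rw [scPsi, schwarzTriangleMap_eq_scFun hw]
  · show Tendsto scPsi _ _
    exact tendsto_scPsi_of_mem_Icc hu
  · have ht : (1 - u)⁻¹ ∈ Ioo (0 : ℝ) 1 :=
      ⟨inv_pos.2 (by linarith), inv_lt_one_of_one_lt₀ (by linarith)⟩
    have hs := scRatio_mem_Ioo ht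
    refine ⟨_, ⟨1 - scRatio ((1 - u)⁻¹), scRatio ((1 - u)⁻¹), by linarith [hs.2], hs.1, by ring, ?_⟩,
      show Tendsto scPsi _ _ from tendsto_scPsi_of_neg hu⟩
    simp only [smul_zero, add_zero, real_smul]
  · have hu0 : 0 < u := by linarith
    have ht : 1 - u⁻¹ ∈ Ioo (0 : ℝ) 1 :=
      ⟨by rw [sub_pos]; exact inv_lt_one_of_one_lt₀ hu, by simp [inv_pos.2 hu0]⟩
    have hs := scRatio_mem_Ioo ht
    refine ⟨_, ⟨1 - scRatio (1 - u⁻¹), scRatio (1 - u⁻¹), by linarith [hs.2], hs.1, by ring, ?_⟩,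
      show Tendsto scPsi _ _ from tendsto_scPsi_of_one_lt hu⟩
    simp only [real_smul, mul_one]
  · show Tendsto scPsi _ _
    exact tendsto_scPsi_atInfty

end Literature.Probability.RandomPlanarGeometry
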